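import Literature.NumberTheory.NumberFields.SqrtTwoTowerFourCoordinates
import HarnessLib

/-!
# THE LEVEL-`64` DYADIC LEMMA: a norm from the four-step `√2`-tower `L = K(s₄) = K·ℚ(ζ₆₄)⁺` whose sixteen tower coordinates are `2`-adically integral
# is `2^m · u` with `u ≡ ±1 (mod 64)` — by the FILTRATION of the local units, not by a residue certificate

Topic `NumberTheory/NumberFields` (namespace `Literature.NumberTheory.NumberFields.SqrtTwoTowerFour`).  THEOREM-ONLY file (no definition, no named fact,
no instance, no `sorry`), written by the prover seat `bsd-line-att-p3` g50 (cell `bsd-f1-sign2`, route `AlignedTransportAtTwo`; `--supports`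
stmt-BirchSwinnertonDyer-22298, closes nothing).  Sequel of att-p3 g46's level-`16` lemma (`QuarticNormFormDyadicResidues.lean`) and att-p3 g49's level-`32` lemma
(`SqrtTwoTowerThreeNormDyadicResidues.lean`), one layer up: the displayed unit hypothesis of att-p4 g42's QUADRATIC-STEP UNIT DOOR
(`IwasawaTheory/ClassicalMuVanishesQuadraticStepNonNormUnitTwo.lean`) at `k = 3` — «a unit of `K_3` that is not a norm from `K_4`» — in base-field congruence
currency (field side: `IwasawaTheory/CyclotomicTwoLayerFourNonNormUnit.lean`, this seat).  Built on `SqrtTwoTowerFourCoordinates.lean` (this seat; setting and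
notation there: fields `K ⊂ K₁ ⊂ K₂ ⊂ K₃ ⊂ L`, `S ⊆ K` a subring, `B₄ = {A + B s₄}` with sixteen coordinates in `S`).

THE METHOD (new for the cell; the residue-certificate method of the level-`16`/`32` files is infeasible at sixteen coordinates).  `S` is `2`-adically digitised
(every element `2q` or `1 + 2q`), local (every `1 + 2q` a unit) and `2` is not a unit.  `B₄/s₄B₄ = S/2S = 𝔽₂`, so every unit `z ∈ B₄` is `a₀(1 +
      s₄w)`, `w ∈ B₄`.
* §3 ★★ THE DEEP LEMMA `exists_norm_one_add_two_mul`: **`N_{L/K}(1 + 2y) ≡ 1 (mod 64)` for every `y ∈ B₄`** — four quadratic steps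
  `N(1 + 2^k Y) = 1 + 2^{k+1}(A + 2^{k−1}(A² − dB²))` carrying one parity bit (the constant coordinate stays even: `a₀ +
        a₀²` is even and `(2+s₃)B²` has even
  constant coordinate).  This is «`N(U^{(16)}) ⊆ U^{(6)}`», i.e. the different `𝔇(ℚ₂(ζ₆₄)⁺/ℚ₂) = 𝔭^{79}`, made explicit.
* §4 ★★ THE FILTRATION `exists_norm_one_add_s4_pow_mul`: **`N_{L/K}(1 + s₄^j w) ≡ ±1 (mod 64)`** for `w ∈ B₄`, by descending induction `j = 16, …, 1`:
  `s₄^{16} = 2ε` (deep lemma); for the step split on the digit of `w₀`: even ⟹ `w = s₄w'`; odd ⟹ `w = 1 + s₄w''` and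
  `(1 + s₄^j + s₄^{j+1}w'')·(1 − s₄^j) = 1 +
        s₄^{j+1}(w'' − s₄^{j−1} − s₄^j w'')`, where `N_{L/K}(1 − s₄^j)` is one of the fifteen integers `≡ ±1 (mod 64)` of the
  coordinates file.  (Group-theoretically: `U/U^{(17)}` is generated by `S^×` and the `1 − s₄^j`, and squares of units are harmless by the level-`32` congruence.)
* §5 ★★ `exists_norm_eq_of_odd` (units of `B₄`: `N ≡ ±1 (mod 64)`, with `a₀^{16} ≡ 1`); ★★★ **`exists_eq_of_norm_eq_pow_mul` — THE LEVEL-`64` LEMMA**: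
  `N_{L/K}(z) = 2^m·u`, `u ∈ S^×` ⟹ `u = ±1 +
        64q` (units; otherwise `z = s₄z'`, `N(s₄) = 2`, induction on `m`); ★★★ `norm_ne_pow_mul_of_not_congr` (the form the
  doors use: `η ≢ ±1 (mod 64S)` ⟹ `N_{L/K}(z) ≠ 2^{16k}·v^{16}η`).
This is the elementary content of «the norm group of `ℚ₂(ζ₆₄)⁺/ℚ₂` on units is `±1 + 64ℤ₂`» (`N ℚ₂(ζ_{2ⁿ})ˣ = 2^ℤ × (1 +
      2ⁿℤ₂)`, local class field theory), in
the one direction the doors need; the same proof pattern gives level `2^{k+2}` at layer `k` from `2^{k}−1` explicit norms.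

HONEST SCOPE: elementary commutative algebra and the field norm; nothing specific to any summit; no number field, class group or certificate for any field is
asserted; BSD is not advanced by this file.  Not in print in this form (it is a by-hand instance of the conductor-discriminant / local reciprocity computation for
`ℚ₂(ζ₆₄)⁺`); nearest print: [NeukirchANT1999] V (1.8)–(1.9), [Washington1997] §13.1, [Omeara1963] §63.

References: [NeukirchANT1999] Ch. I §2, Ch. II §5 (filtration `U^{(n)}`), Ch. III §2 (different), Ch. V §1 (norm groups of `ℚ_p(ζ_{pⁿ})`); [Omeara1963] §63A–B;
[Washington1997] §13.1 (`ℚ_4 = ℚ(ζ₆₄)⁺`, `K_4 = K·ℚ_4`), §13.3.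
-/

set_option autoImplicit false

noncomputable section

namespace Literature.NumberTheory.NumberFields.SqrtTwoTowerFour

open Literature.NumberTheory.NumberFields Literature.NumberTheory.IwasawaTheory

variable {K K₁ K₂ K₃ L : Type*} [Field K] [Field K₁] [Field K₂] [Field K₃] [Field L]
  [Algebra K K₁] [Algebra K₁ K₂] [Algebra K K₂] [IsScalarTower K K₁ K₂]
  [Algebra K₂ K₃] [Algebra K K₃] [Algebra K₁ K₃] [IsScalarTower K K₂ K₃] [IsScalarTower K₁ K₂ K₃]
  [Algebra K₃ L] [Algebra K L] [IsScalarTower K K₃ L]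

/-! ## §0 (private copies of the coordinates file's helpers: relations, numerals, digits) -/

/-- The tower relations read in `K₃`. [folklore] -/
private theorem rel₃ {s₁ : K₁} (hs₁ : s₁ ^ 2 = 2) {s₂ : K₂} (hs₂ : s₂ ^ 2 = algebraMap K₁ K₂ (2 +
      s₁)) {s₃ : K₃} (hs₃ : s₃ ^ 2 = algebraMap K₂ K₃ (2 + s₂)) :
    (algebraMap K₁ K₃ s₁) ^ 2 = 2 ∧ (algebraMap K₂ K₃ s₂) ^ 2 = 2 + algebraMap K₁ K₃ s₁ ∧
      s₃ ^ 2 = 2 + algebraMap K₂ K₃ s₂ := by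
  refine ⟨by rw [← map_pow, hs₁, map_ofNat], ?_, by rw [hs₃, map_add, map_ofNat]⟩
  rw [← map_pow, hs₂, ← IsScalarTower.algebraMap_apply, map_add, map_ofNat]

/-- The tower relations read in `L`. [folklore] -/
private theorem rel₄ {s₁ : K₁} (hs₁ : s₁ ^ 2 = 2) {s₂ : K₂} (hs₂ : s₂ ^ 2 = algebraMap K₁ K₂ (2 +
      s₁)) {s₃ : K₃} (hs₃ : s₃ ^ 2 = algebraMap K₂ K₃ (2 + s₂)) {s₄ : L} (hs₄ : s₄ ^ 2 = algebraMap K₃ L (2 + s₃)) :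
    (algebraMap K₃ L (algebraMap K₁ K₃ s₁)) ^ 2 = 2 ∧
      (algebraMap K₃ L (algebraMap K₂ K₃ s₂)) ^ 2 = 2 + algebraMap K₃ L (algebraMap K₁ K₃ s₁) ∧
      (algebraMap K₃ L s₃) ^ 2 = 2 + algebraMap K₃ L (algebraMap K₂ K₃ s₂) ∧ s₄ ^ 2 = 2 + algebraMap K₃ L s₃ := by
  obtain ⟨h1, h2, h3⟩ := rel₃ hs₁ hs₂ hs₃
  refine ⟨by rw [← map_pow, h1, map_ofNat], by rw [← map_pow, h2, map_add, map_ofNat],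
    by rw [← map_pow, h3, map_add, map_ofNat], by rw [hs₄, map_add, map_ofNat]⟩

variable (S : Subring K)

omit [Algebra K K₁] in
/-- Numerals of the subring coerce to numerals. [folklore] -/
@[simp, norm_cast] private theorem coe_ofNat_subring (n : ℕ) [n.AtLeastTwo] : ((ofNat(n) : S) : K) = ofNat(n) := rfl

omit [Algebra K K₁] in
/-- In a `2`-adically digitised ring, `r + r² = r(r+1)` is even. [folklore] -/
private theorem exists_add_sq_eq_two_mul (hdig : ∀ r : S, ∃ q : S, r = 2 * q ∨ r = 1 + 2 * q) (r : S) : ∃ g : S, r + r ^ 2 = 2 * g := by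
  obtain ⟨q, rfl | rfl⟩ := hdig r
  · exact ⟨q + 2 * q ^ 2, by ring⟩
  · exact ⟨(1 + 2 * q) * (1 + q), by ring⟩

omit [Algebra K K₁] in
/-- In a `2`-adically digitised ring, `(1 + 2e)¹⁶ ≡ 1 (mod 64)`. [folklore] -/
private theorem exists_pow_sixteen_eq (hdig : ∀ r : S, ∃ q : S, r = 2 * q ∨ r = 1 + 2 * q) (e : S) : ∃ r : S, (1 + 2 * e) ^ 16 = 1 + 64 * r := by
  obtain ⟨g, hg⟩ := exists_add_sq_eq_two_mul S hdig e
  exact ⟨g + 7 * e ^ 2 + 1024 * e ^ 16 + 8192 * e ^ 15 + 30720 * e ^ 14 + 71680 * e ^ 13 + 116480 * e ^ 12 + 139776 * e ^ 11 + 128128 * e ^ 10 +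
        91520 * e ^ 9 + 51480 * e ^ 8 + 22880 * e ^ 7 + 8008 * e ^ 6 + 2184 * e ^ 5 + 455 * e ^ 4 + 70 * e ^ 3, by linear_combination (32 : S) * hg⟩

omit [Algebra K K₁] in
/-- In a `2`-adically digitised ring in which `2` is not a unit, a unit `v` has `v¹⁶ ≡ 1 (mod 64)`. [folklore] -/
private theorem exists_unit_pow_sixteen_eq (hdig : ∀ r : S, ∃ q : S, r = 2 * q ∨ r = 1 + 2 * q) (h2S : ¬ IsUnit (2 : S)) {v : S} (hv : IsUnit v) :
    ∃ r : S, v ^ 16 = 1 + 64 * r := by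
  obtain ⟨e, rfl | rfl⟩ := hdig v
  · exact absurd (isUnit_of_mul_isUnit_left hv) h2S
  · exact exists_pow_sixteen_eq S hdig e

/-! ## §3 ★★ THE DEEP LEMMA: `N_{L/K}(1 + 2y) ≡ 1 (mod 64)` for every `y ∈ B₄`

Four quadratic norm steps `N(1 + 2^k·Y) = (1 + 2^k A)² − d (2^k B)² = 1 + 2^{k+1}(A + 2^{k−1}(A² − dB²))` (`Y = A +
      B s`), `k = 1, 2, 3, 4` down the tower, keeping
track of ONE bit: the constant coordinate of `A + 2^{k−1} N(Y)` is even (for `k = 1` because `a₀ + a₀² = a₀(a₀ + 1)` is even and `(2 +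
      s₃)·B²` has even constant
coordinate; for `k ≥ 2` trivially).  This is the different of `ℚ₂(ζ₆₄)⁺/ℚ₂` (exponent `79`: `Tr(𝔪^{17}) ⊆ 2⁶ℤ₂`) made explicit. -/

omit [Algebra K₂ K₃] [Algebra K K₃] [Algebra K₁ K₃] [IsScalarTower K K₂ K₃] [IsScalarTower K₁ K₂ K₃] [Algebra K₃ L] [Algebra K L] [IsScalarTower K K₃ L] in
/-- The tower relations read in `K₂`. [folklore] -/
private theorem rel₂ {s₁ : K₁} (hs₁ : s₁ ^ 2 = 2) {s₂ : K₂} (hs₂ : s₂ ^ 2 = algebraMap K₁ K₂ (2 + s₁)) :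
    (algebraMap K₁ K₂ s₁) ^ 2 = 2 ∧ s₂ ^ 2 = 2 + algebraMap K₁ K₂ s₁ :=
  ⟨by rw [← map_pow, hs₁, map_ofNat], by rw [hs₂, map_add, map_ofNat]⟩

set_option maxHeartbeats 1600000 in
omit [Algebra K K₁] [Algebra K K₂] [IsScalarTower K K₁ K₂] [IsScalarTower K K₂ K₃] [Algebra K L] [IsScalarTower K K₃ L] in
/-- Step `L/K₃`: `N_{L/K₃}(1 + 2(A + B s₄)) = 1 + 4·C` with `C = A + A² − (2+s₃)B² ∈ B₃` and `C₀` EVEN. [cite: NeukirchANT1999, Ch. I §2 Prop. (2.6)]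
[cite: NeukirchANT1999, Ch. III §2 (different and trace of a tower)] -/
theorem exists_norm43_one_add_two_mul [FiniteDimensional K₃ L] [IsGalois K₃ L] (h4 : Module.finrank K₃ L = 2)
    {s₁ : K₁} (hs₁ : s₁ ^ 2 = 2) {s₂ : K₂} (hs₂ : s₂ ^ 2 = algebraMap K₁ K₂ (2 + s₁)) {s₃ : K₃} (hs₃ : s₃ ^ 2 = algebraMap K₂ K₃ (2 +
          s₂)) {s₄ : L} (hs₄ : s₄ ^ 2 = algebraMap K₃ L (2 + s₃)) (hs₄K : ∀ x : K₃, algebraMap K₃ L x ≠ s₄)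
    (hdig : ∀ r : S, ∃ q : S, r = 2 * q ∨ r = 1 + 2 * q) (a b : Fin 8 → S) : ∃ c : Fin 8 → S, ∃ g : S, c 0 = 2 * g ∧
    Algebra.norm K₃ (1 + 2 * (algebraMap K₃ L (algebraMap K K₃ (a 0 : K) + algebraMap K K₃ (a 1 : K) * algebraMap K₁ K₃ s₁ +
          (algebraMap K K₃ (a 2 : K) + algebraMap K K₃ (a 3 : K) * algebraMap K₁ K₃ s₁) * algebraMap K₂ K₃ s₂ + (algebraMap K K₃ (a 4 : K) +
          algebraMap K K₃ (a 5 : K) * algebraMap K₁ K₃ s₁ + (algebraMap K K₃ (a 6 : K) +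
          algebraMap K K₃ (a 7 : K) * algebraMap K₁ K₃ s₁) * algebraMap K₂ K₃ s₂) * s₃) + algebraMap K₃ L (algebraMap K K₃ (b 0 : K) +
          algebraMap K K₃ (b 1 : K) * algebraMap K₁ K₃ s₁ + (algebraMap K K₃ (b 2 : K) +
          algebraMap K K₃ (b 3 : K) * algebraMap K₁ K₃ s₁) * algebraMap K₂ K₃ s₂ + (algebraMap K K₃ (b 4 : K) +
          algebraMap K K₃ (b 5 : K) * algebraMap K₁ K₃ s₁ + (algebraMap K K₃ (b 6 : K) +
          algebraMap K K₃ (b 7 : K) * algebraMap K₁ K₃ s₁) * algebraMap K₂ K₃ s₂) * s₃) * s₄)) =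
      1 + 4 * (algebraMap K K₃ (c 0 : K) + algebraMap K K₃ (c 1 : K) * algebraMap K₁ K₃ s₁ + (algebraMap K K₃ (c 2 : K) +
            algebraMap K K₃ (c 3 : K) * algebraMap K₁ K₃ s₁) * algebraMap K₂ K₃ s₂ + (algebraMap K K₃ (c 4 : K) +
            algebraMap K K₃ (c 5 : K) * algebraMap K₁ K₃ s₁ + (algebraMap K K₃ (c 6 : K) +
            algebraMap K K₃ (c 7 : K) * algebraMap K₁ K₃ s₁) * algebraMap K₂ K₃ s₂) * s₃) := by
  obtain ⟨g₀, hg₀⟩ := exists_add_sq_eq_two_mul S hdig (a 0)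
  obtain ⟨hR₁, hR₂, hR₃⟩ := rel₃ hs₁ hs₂ hs₃
  set R₁ := algebraMap K₁ K₃ s₁ with hR₁def
  set R₂ := algebraMap K₂ K₃ s₂ with hR₂def
  refine ⟨![2 * a 1 ^ 2 + 4 * a 2 * a 3 + 2 * a 2 ^ 2 + 4 * a 3 ^ 2 + 4 * a 4 * a 6 + 4 * a 4 * a 7 + 2 * a 4 ^ 2 + 4 * a 5 * a 6 + 8 * a 5 * a 7 +
        4 * a 5 ^ 2 + 8 * a 6 * a 7 + 4 * a 6 ^ 2 + 8 * a 7 ^ 2 - 4 * b 0 * b 4 - 4 * b 0 * b 6 - 4 * b 0 * b 7 - 2 * b 0 ^ 2 - 8 * b 1 * b 5 -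
        4 * b 1 * b 6 - 8 * b 1 * b 7 - 4 * b 1 ^ 2 - 8 * b 2 * b 3 - 4 * b 2 * b 4 - 4 * b 2 * b 5 - 8 * b 2 * b 6 - 8 * b 2 * b 7 - 4 * b 2 ^ 2 -
        4 * b 3 * b 4 - 8 * b 3 * b 5 - 8 * b 3 * b 6 - 16 * b 3 * b 7 - 8 * b 3 ^ 2 - 8 * b 4 * b 6 - 8 * b 4 * b 7 - 4 * b 4 ^ 2 - 8 * b 5 * b 6 -
        16 * b 5 * b 7 - 8 * b 5 ^ 2 - 16 * b 6 * b 7 - 8 * b 6 ^ 2 - 16 * b 7 ^ 2 + 2 * g₀, 2 * a 0 * a 1 + 4 * a 2 * a 3 + a 2 ^ 2 + 2 * a 3 ^ 2 +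
        4 * a 4 * a 5 + 2 * a 4 * a 6 + 4 * a 4 * a 7 + 4 * a 5 * a 6 + 4 * a 5 * a 7 + 8 * a 6 * a 7 + 2 * a 6 ^ 2 + 4 * a 7 ^ 2 - 4 * b 0 * b 1 -
        4 * b 0 * b 5 - 2 * b 0 * b 6 - 4 * b 0 * b 7 - 4 * b 1 * b 4 - 4 * b 1 * b 6 - 4 * b 1 * b 7 - 8 * b 2 * b 3 - 2 * b 2 * b 4 -
        4 * b 2 * b 5 - 4 * b 2 * b 6 - 8 * b 2 * b 7 - 2 * b 2 ^ 2 - 4 * b 3 * b 4 - 4 * b 3 * b 5 - 8 * b 3 * b 6 - 8 * b 3 * b 7 - 4 * b 3 ^ 2 -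
        8 * b 4 * b 5 - 4 * b 4 * b 6 - 8 * b 4 * b 7 - 8 * b 5 * b 6 - 8 * b 5 * b 7 - 16 * b 6 * b 7 - 4 * b 6 ^ 2 - 8 * b 7 ^ 2 +
        a 1, 2 * a 0 * a 2 + 4 * a 1 * a 3 + 4 * a 4 * a 6 + a 4 ^ 2 + 8 * a 5 * a 7 + 2 * a 5 ^ 2 + 4 * a 6 * a 7 + 2 * a 6 ^ 2 + 4 * a 7 ^ 2 -
        4 * b 0 * b 2 - 2 * b 0 * b 4 - 4 * b 0 * b 6 - 8 * b 1 * b 3 - 4 * b 1 * b 5 - 8 * b 1 * b 7 - 4 * b 2 * b 4 - 4 * b 2 * b 6 -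
        4 * b 2 * b 7 - 8 * b 3 * b 5 - 4 * b 3 * b 6 - 8 * b 3 * b 7 - 8 * b 4 * b 6 - 2 * b 4 ^ 2 - 16 * b 5 * b 7 - 4 * b 5 ^ 2 - 8 * b 6 * b 7 -
        4 * b 6 ^ 2 - 8 * b 7 ^ 2 + a 2, 2 * a 0 * a 3 + 2 * a 1 * a 2 + 2 * a 4 * a 5 + 4 * a 4 * a 7 + 4 * a 5 * a 6 + 4 * a 6 * a 7 + a 6 ^ 2 +
        2 * a 7 ^ 2 - 4 * b 0 * b 3 - 2 * b 0 * b 5 - 4 * b 0 * b 7 - 4 * b 1 * b 2 - 2 * b 1 * b 4 - 4 * b 1 * b 6 - 4 * b 2 * b 5 - 2 * b 2 * b 6 -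
        4 * b 2 * b 7 - 4 * b 3 * b 4 - 4 * b 3 * b 6 - 4 * b 3 * b 7 - 4 * b 4 * b 5 - 8 * b 4 * b 7 - 8 * b 5 * b 6 - 8 * b 6 * b 7 - 2 * b 6 ^ 2 -
        4 * b 7 ^ 2 + a 3, 2 * a 0 * a 4 + 4 * a 1 * a 5 + 4 * a 2 * a 6 + 4 * a 2 * a 7 + 4 * a 3 * a 6 + 8 * a 3 * a 7 - 4 * b 0 * b 4 - b 0 ^ 2 -
        8 * b 1 * b 5 - 2 * b 1 ^ 2 - 4 * b 2 * b 3 - 8 * b 2 * b 6 - 8 * b 2 * b 7 - 2 * b 2 ^ 2 - 8 * b 3 * b 6 - 16 * b 3 * b 7 - 4 * b 3 ^ 2 -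
        4 * b 4 * b 6 - 4 * b 4 * b 7 - 2 * b 4 ^ 2 - 4 * b 5 * b 6 - 8 * b 5 * b 7 - 4 * b 5 ^ 2 - 8 * b 6 * b 7 - 4 * b 6 ^ 2 - 8 * b 7 ^ 2 +
        a 4, 2 * a 0 * a 5 + 2 * a 1 * a 4 + 2 * a 2 * a 6 + 4 * a 2 * a 7 + 4 * a 3 * a 6 + 4 * a 3 * a 7 - 2 * b 0 * b 1 - 4 * b 0 * b 5 -
        4 * b 1 * b 4 - 4 * b 2 * b 3 - 4 * b 2 * b 6 - 8 * b 2 * b 7 - b 2 ^ 2 - 8 * b 3 * b 6 - 8 * b 3 * b 7 - 2 * b 3 ^ 2 - 4 * b 4 * b 5 -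
        2 * b 4 * b 6 - 4 * b 4 * b 7 - 4 * b 5 * b 6 - 4 * b 5 * b 7 - 8 * b 6 * b 7 - 2 * b 6 ^ 2 - 4 * b 7 ^ 2 + a 5, 2 * a 0 * a 6 +
        4 * a 1 * a 7 + 2 * a 2 * a 4 + 4 * a 3 * a 5 - 2 * b 0 * b 2 - 4 * b 0 * b 6 - 4 * b 1 * b 3 - 8 * b 1 * b 7 - 4 * b 2 * b 4 -
        8 * b 3 * b 5 - 4 * b 4 * b 6 - b 4 ^ 2 - 8 * b 5 * b 7 - 2 * b 5 ^ 2 - 4 * b 6 * b 7 - 2 * b 6 ^ 2 - 4 * b 7 ^ 2 + a 6, 2 * a 0 * a 7 +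
        2 * a 1 * a 6 + 2 * a 2 * a 5 + 2 * a 3 * a 4 - 2 * b 0 * b 3 - 4 * b 0 * b 7 - 2 * b 1 * b 2 - 4 * b 1 * b 6 - 4 * b 2 * b 5 -
        4 * b 3 * b 4 - 2 * b 4 * b 5 - 4 * b 4 * b 7 - 4 * b 5 * b 6 - 4 * b 6 * b 7 - b 6 ^ 2 - 2 * b 7 ^ 2 + a 7],
    a 1 ^ 2 + 2 * a 2 * a 3 + a 2 ^ 2 + 2 * a 3 ^ 2 + 2 * a 4 * a 6 + 2 * a 4 * a 7 + a 4 ^ 2 + 2 * a 5 * a 6 + 4 * a 5 * a 7 + 2 * a 5 ^ 2 +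
          4 * a 6 * a 7 + 2 * a 6 ^ 2 + 4 * a 7 ^ 2 - 2 * b 0 * b 4 - 2 * b 0 * b 6 - 2 * b 0 * b 7 - b 0 ^ 2 - 4 * b 1 * b 5 - 2 * b 1 * b 6 -
          4 * b 1 * b 7 - 2 * b 1 ^ 2 - 4 * b 2 * b 3 - 2 * b 2 * b 4 - 2 * b 2 * b 5 - 4 * b 2 * b 6 - 4 * b 2 * b 7 - 2 * b 2 ^ 2 - 2 * b 3 * b 4 -
          4 * b 3 * b 5 - 4 * b 3 * b 6 - 8 * b 3 * b 7 - 4 * b 3 ^ 2 - 4 * b 4 * b 6 - 4 * b 4 * b 7 - 2 * b 4 ^ 2 - 4 * b 5 * b 6 - 8 * b 5 * b 7 -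
          4 * b 5 ^ 2 - 8 * b 6 * b 7 - 4 * b 6 ^ 2 - 8 * b 7 ^ 2 + g₀, by simp only [Matrix.cons_val_zero]; ring, ?_⟩
  have e : 1 + 2 * (algebraMap K₃ L (algebraMap K K₃ (a 0 : K) + algebraMap K K₃ (a 1 : K) * algebraMap K₁ K₃ s₁ + (algebraMap K K₃ (a 2 : K) +
        algebraMap K K₃ (a 3 : K) * algebraMap K₁ K₃ s₁) * algebraMap K₂ K₃ s₂ + (algebraMap K K₃ (a 4 : K) +
        algebraMap K K₃ (a 5 : K) * algebraMap K₁ K₃ s₁ + (algebraMap K K₃ (a 6 : K) +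
        algebraMap K K₃ (a 7 : K) * algebraMap K₁ K₃ s₁) * algebraMap K₂ K₃ s₂) * s₃) + algebraMap K₃ L (algebraMap K K₃ (b 0 : K) +
        algebraMap K K₃ (b 1 : K) * algebraMap K₁ K₃ s₁ + (algebraMap K K₃ (b 2 : K) +
        algebraMap K K₃ (b 3 : K) * algebraMap K₁ K₃ s₁) * algebraMap K₂ K₃ s₂ + (algebraMap K K₃ (b 4 : K) +
        algebraMap K K₃ (b 5 : K) * algebraMap K₁ K₃ s₁ + (algebraMap K K₃ (b 6 : K) +
        algebraMap K K₃ (b 7 : K) * algebraMap K₁ K₃ s₁) * algebraMap K₂ K₃ s₂) * s₃) * s₄) =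
      algebraMap K₃ L (1 + 2 * (algebraMap K K₃ (a 0 : K) + algebraMap K K₃ (a 1 : K) * algebraMap K₁ K₃ s₁ + (algebraMap K K₃ (a 2 : K) +
            algebraMap K K₃ (a 3 : K) * algebraMap K₁ K₃ s₁) * algebraMap K₂ K₃ s₂ + (algebraMap K K₃ (a 4 : K) +
            algebraMap K K₃ (a 5 : K) * algebraMap K₁ K₃ s₁ + (algebraMap K K₃ (a 6 : K) +
            algebraMap K K₃ (a 7 : K) * algebraMap K₁ K₃ s₁) * algebraMap K₂ K₃ s₂) * s₃)) +
      algebraMap K₃ L (2 * (algebraMap K K₃ (b 0 : K) + algebraMap K K₃ (b 1 : K) * algebraMap K₁ K₃ s₁ + (algebraMap K K₃ (b 2 : K) +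
            algebraMap K K₃ (b 3 : K) * algebraMap K₁ K₃ s₁) * algebraMap K₂ K₃ s₂ + (algebraMap K K₃ (b 4 : K) +
            algebraMap K K₃ (b 5 : K) * algebraMap K₁ K₃ s₁ + (algebraMap K K₃ (b 6 : K) +
            algebraMap K K₃ (b 7 : K) * algebraMap K₁ K₃ s₁) * algebraMap K₂ K₃ s₂) * s₃)) * s₄ := by
    simp only [map_add, map_mul, map_one, map_ofNat]; ring
  rw [e, norm_add_mul_eq_sq_sub_mul_sq h4 hs₄ hs₄K]
  have hgK : ((a 0 : S) : K) + ((a 0 : S) : K) ^ 2 = 2 * ((g₀ : S) : K) := by exact_mod_cast hg₀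
  have hg := congrArg (algebraMap K K₃) hgK
  push_cast [map_ofNat] at hg
  push_cast [Matrix.cons_val_zero, Matrix.cons_val_one, Matrix.cons_val, coe_ofNat_subring, map_ofNat, map_one, map_zero, map_neg, ← IsScalarTower.algebraMap_apply, ← hR₁def, ← hR₂def]
  linear_combination (-4 * algebraMap K K₃ (b 7 : K) ^ 2 * R₁ * R₂ * s₃ + 8 * algebraMap K K₃ (a 1 : K) * algebraMap K K₃ (a 7 : K) * R₂ * s₃ +
        8 * algebraMap K K₃ (a 3 : K) * algebraMap K K₃ (a 5 : K) * R₂ * s₃ + 8 * algebraMap K K₃ (a 3 : K) * algebraMap K K₃ (a 7 : K) * R₁ * s₃ +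
        4 * algebraMap K K₃ (a 7 : K) ^ 2 * R₁ * R₂ - 8 * algebraMap K K₃ (b 1 : K) * algebraMap K K₃ (b 3 : K) * R₂ * s₃ -
        16 * algebraMap K K₃ (b 1 : K) * algebraMap K K₃ (b 7 : K) * R₂ * s₃ - 16 * algebraMap K K₃ (b 3 : K) * algebraMap K K₃ (b 5 : K) * R₂ * s₃ -
        8 * algebraMap K K₃ (b 3 : K) * algebraMap K K₃ (b 7 : K) * R₁ * R₂ - 16 * algebraMap K K₃ (b 3 : K) * algebraMap K K₃ (b 7 : K) * R₁ * s₃ -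
        4 * algebraMap K K₃ (b 3 : K) ^ 2 * R₁ * s₃ - 8 * algebraMap K K₃ (b 5 : K) * algebraMap K K₃ (b 7 : K) * R₁ * s₃ -
        16 * algebraMap K K₃ (b 5 : K) * algebraMap K K₃ (b 7 : K) * R₂ * s₃ - 4 * algebraMap K K₃ (b 5 : K) ^ 2 * R₂ * s₃ -
        8 * algebraMap K K₃ (b 6 : K) * algebraMap K K₃ (b 7 : K) * R₂ * s₃ - 8 * algebraMap K K₃ (b 7 : K) ^ 2 * R₁ * R₂ -
        8 * algebraMap K K₃ (b 7 : K) ^ 2 * R₁ * s₃ - 8 * algebraMap K K₃ (b 7 : K) ^ 2 * R₂ * s₃ +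
        8 * algebraMap K K₃ (a 1 : K) * algebraMap K K₃ (a 3 : K) * R₂ + 8 * algebraMap K K₃ (a 1 : K) * algebraMap K K₃ (a 5 : K) * s₃ +
        8 * algebraMap K K₃ (a 2 : K) * algebraMap K K₃ (a 7 : K) * s₃ + 8 * algebraMap K K₃ (a 3 : K) * algebraMap K K₃ (a 6 : K) * s₃ +
        16 * algebraMap K K₃ (a 3 : K) * algebraMap K K₃ (a 7 : K) * s₃ + 4 * algebraMap K K₃ (a 3 : K) ^ 2 * R₁ +
        8 * algebraMap K K₃ (a 5 : K) * algebraMap K K₃ (a 7 : K) * R₁ + 16 * algebraMap K K₃ (a 5 : K) * algebraMap K K₃ (a 7 : K) * R₂ +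
        4 * algebraMap K K₃ (a 5 : K) ^ 2 * R₂ + 8 * algebraMap K K₃ (a 6 : K) * algebraMap K K₃ (a 7 : K) * R₂ +
        8 * algebraMap K K₃ (a 7 : K) ^ 2 * R₁ + 8 * algebraMap K K₃ (a 7 : K) ^ 2 * R₂ -
        16 * algebraMap K K₃ (b 1 : K) * algebraMap K K₃ (b 3 : K) * R₂ - 8 * algebraMap K K₃ (b 1 : K) * algebraMap K K₃ (b 5 : K) * R₂ -
        16 * algebraMap K K₃ (b 1 : K) * algebraMap K K₃ (b 5 : K) * s₃ - 8 * algebraMap K K₃ (b 1 : K) * algebraMap K K₃ (b 7 : K) * R₁ -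
        16 * algebraMap K K₃ (b 1 : K) * algebraMap K K₃ (b 7 : K) * R₂ - 4 * algebraMap K K₃ (b 1 : K) ^ 2 * s₃ -
        8 * algebraMap K K₃ (b 2 : K) * algebraMap K K₃ (b 3 : K) * s₃ - 8 * algebraMap K K₃ (b 2 : K) * algebraMap K K₃ (b 7 : K) * R₂ -
        16 * algebraMap K K₃ (b 2 : K) * algebraMap K K₃ (b 7 : K) * s₃ - 8 * algebraMap K K₃ (b 3 : K) * algebraMap K K₃ (b 5 : K) * R₁ -
        16 * algebraMap K K₃ (b 3 : K) * algebraMap K K₃ (b 5 : K) * R₂ - 8 * algebraMap K K₃ (b 3 : K) * algebraMap K K₃ (b 6 : K) * R₂ -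
        16 * algebraMap K K₃ (b 3 : K) * algebraMap K K₃ (b 6 : K) * s₃ - 16 * algebraMap K K₃ (b 3 : K) * algebraMap K K₃ (b 7 : K) * R₁ -
        16 * algebraMap K K₃ (b 3 : K) * algebraMap K K₃ (b 7 : K) * R₂ - 32 * algebraMap K K₃ (b 3 : K) * algebraMap K K₃ (b 7 : K) * s₃ -
        8 * algebraMap K K₃ (b 3 : K) ^ 2 * R₁ - 8 * algebraMap K K₃ (b 3 : K) ^ 2 * s₃ -
        8 * algebraMap K K₃ (b 4 : K) * algebraMap K K₃ (b 7 : K) * s₃ - 8 * algebraMap K K₃ (b 5 : K) * algebraMap K K₃ (b 6 : K) * s₃ -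
        16 * algebraMap K K₃ (b 5 : K) * algebraMap K K₃ (b 7 : K) * R₁ - 32 * algebraMap K K₃ (b 5 : K) * algebraMap K K₃ (b 7 : K) * R₂ -
        16 * algebraMap K K₃ (b 5 : K) * algebraMap K K₃ (b 7 : K) * s₃ - 8 * algebraMap K K₃ (b 5 : K) ^ 2 * R₂ -
        8 * algebraMap K K₃ (b 5 : K) ^ 2 * s₃ - 16 * algebraMap K K₃ (b 6 : K) * algebraMap K K₃ (b 7 : K) * R₂ -
        16 * algebraMap K K₃ (b 6 : K) * algebraMap K K₃ (b 7 : K) * s₃ - 16 * algebraMap K K₃ (b 7 : K) ^ 2 * R₁ -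
        16 * algebraMap K K₃ (b 7 : K) ^ 2 * R₂ - 16 * algebraMap K K₃ (b 7 : K) ^ 2 * s₃ + 4 * algebraMap K K₃ (a 1 : K) ^ 2 +
        8 * algebraMap K K₃ (a 2 : K) * algebraMap K K₃ (a 3 : K) + 8 * algebraMap K K₃ (a 3 : K) ^ 2 +
        8 * algebraMap K K₃ (a 4 : K) * algebraMap K K₃ (a 7 : K) + 8 * algebraMap K K₃ (a 5 : K) * algebraMap K K₃ (a 6 : K) +
        16 * algebraMap K K₃ (a 5 : K) * algebraMap K K₃ (a 7 : K) + 8 * algebraMap K K₃ (a 5 : K) ^ 2 +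
        16 * algebraMap K K₃ (a 6 : K) * algebraMap K K₃ (a 7 : K) + 16 * algebraMap K K₃ (a 7 : K) ^ 2 -
        8 * algebraMap K K₃ (b 0 : K) * algebraMap K K₃ (b 7 : K) - 16 * algebraMap K K₃ (b 1 : K) * algebraMap K K₃ (b 5 : K) -
        8 * algebraMap K K₃ (b 1 : K) * algebraMap K K₃ (b 6 : K) - 16 * algebraMap K K₃ (b 1 : K) * algebraMap K K₃ (b 7 : K) -
        8 * algebraMap K K₃ (b 1 : K) ^ 2 - 16 * algebraMap K K₃ (b 2 : K) * algebraMap K K₃ (b 3 : K) -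
        8 * algebraMap K K₃ (b 2 : K) * algebraMap K K₃ (b 5 : K) - 16 * algebraMap K K₃ (b 2 : K) * algebraMap K K₃ (b 7 : K) -
        8 * algebraMap K K₃ (b 3 : K) * algebraMap K K₃ (b 4 : K) - 16 * algebraMap K K₃ (b 3 : K) * algebraMap K K₃ (b 5 : K) -
        16 * algebraMap K K₃ (b 3 : K) * algebraMap K K₃ (b 6 : K) - 32 * algebraMap K K₃ (b 3 : K) * algebraMap K K₃ (b 7 : K) -
        16 * algebraMap K K₃ (b 3 : K) ^ 2 - 16 * algebraMap K K₃ (b 4 : K) * algebraMap K K₃ (b 7 : K) -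
        16 * algebraMap K K₃ (b 5 : K) * algebraMap K K₃ (b 6 : K) - 32 * algebraMap K K₃ (b 5 : K) * algebraMap K K₃ (b 7 : K) -
        16 * algebraMap K K₃ (b 5 : K) ^ 2 - 32 * algebraMap K K₃ (b 6 : K) * algebraMap K K₃ (b 7 : K) - 32 * algebraMap K K₃ (b 7 : K) ^ 2) * hR₁ +
        (-4 * algebraMap K K₃ (b 7 : K) ^ 2 * R₁ ^ 2 * R₂ * s₃ + 8 * algebraMap K K₃ (a 3 : K) * algebraMap K K₃ (a 7 : K) * R₁ ^ 2 * s₃ +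
        4 * algebraMap K K₃ (a 7 : K) ^ 2 * R₁ ^ 2 * R₂ - 8 * algebraMap K K₃ (b 3 : K) * algebraMap K K₃ (b 7 : K) * R₁ ^ 2 * R₂ -
        16 * algebraMap K K₃ (b 3 : K) * algebraMap K K₃ (b 7 : K) * R₁ ^ 2 * s₃ - 4 * algebraMap K K₃ (b 3 : K) ^ 2 * R₁ ^ 2 * s₃ -
        8 * algebraMap K K₃ (b 5 : K) * algebraMap K K₃ (b 7 : K) * R₁ ^ 2 * s₃ -
        8 * algebraMap K K₃ (b 6 : K) * algebraMap K K₃ (b 7 : K) * R₁ * R₂ * s₃ - 8 * algebraMap K K₃ (b 7 : K) ^ 2 * R₁ ^ 2 * R₂ -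
        8 * algebraMap K K₃ (b 7 : K) ^ 2 * R₁ ^ 2 * s₃ + 8 * algebraMap K K₃ (a 2 : K) * algebraMap K K₃ (a 7 : K) * R₁ * s₃ +
        8 * algebraMap K K₃ (a 3 : K) * algebraMap K K₃ (a 6 : K) * R₁ * s₃ + 4 * algebraMap K K₃ (a 3 : K) ^ 2 * R₁ ^ 2 +
        8 * algebraMap K K₃ (a 5 : K) * algebraMap K K₃ (a 7 : K) * R₁ ^ 2 + 8 * algebraMap K K₃ (a 6 : K) * algebraMap K K₃ (a 7 : K) * R₁ * R₂ +
        8 * algebraMap K K₃ (a 7 : K) ^ 2 * R₁ ^ 2 - 8 * algebraMap K K₃ (b 1 : K) * algebraMap K K₃ (b 7 : K) * R₁ ^ 2 -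
        8 * algebraMap K K₃ (b 2 : K) * algebraMap K K₃ (b 3 : K) * R₁ * s₃ - 8 * algebraMap K K₃ (b 2 : K) * algebraMap K K₃ (b 7 : K) * R₁ * R₂ -
        16 * algebraMap K K₃ (b 2 : K) * algebraMap K K₃ (b 7 : K) * R₁ * s₃ - 8 * algebraMap K K₃ (b 3 : K) * algebraMap K K₃ (b 5 : K) * R₁ ^ 2 -
        8 * algebraMap K K₃ (b 3 : K) * algebraMap K K₃ (b 6 : K) * R₁ * R₂ - 16 * algebraMap K K₃ (b 3 : K) * algebraMap K K₃ (b 6 : K) * R₁ * s₃ -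
        16 * algebraMap K K₃ (b 3 : K) * algebraMap K K₃ (b 7 : K) * R₁ ^ 2 - 8 * algebraMap K K₃ (b 3 : K) ^ 2 * R₁ ^ 2 -
        8 * algebraMap K K₃ (b 4 : K) * algebraMap K K₃ (b 7 : K) * R₁ * s₃ - 8 * algebraMap K K₃ (b 5 : K) * algebraMap K K₃ (b 6 : K) * R₁ * s₃ -
        16 * algebraMap K K₃ (b 5 : K) * algebraMap K K₃ (b 7 : K) * R₁ ^ 2 - 16 * algebraMap K K₃ (b 6 : K) * algebraMap K K₃ (b 7 : K) * R₁ * R₂ -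
        16 * algebraMap K K₃ (b 6 : K) * algebraMap K K₃ (b 7 : K) * R₁ * s₃ - 4 * algebraMap K K₃ (b 6 : K) ^ 2 * R₂ * s₃ -
        16 * algebraMap K K₃ (b 7 : K) ^ 2 * R₁ ^ 2 + 8 * algebraMap K K₃ (a 2 : K) * algebraMap K K₃ (a 3 : K) * R₁ +
        8 * algebraMap K K₃ (a 2 : K) * algebraMap K K₃ (a 6 : K) * s₃ + 8 * algebraMap K K₃ (a 4 : K) * algebraMap K K₃ (a 7 : K) * R₁ +
        8 * algebraMap K K₃ (a 5 : K) * algebraMap K K₃ (a 6 : K) * R₁ + 16 * algebraMap K K₃ (a 6 : K) * algebraMap K K₃ (a 7 : K) * R₁ +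
        4 * algebraMap K K₃ (a 6 : K) ^ 2 * R₂ - 8 * algebraMap K K₃ (b 0 : K) * algebraMap K K₃ (b 7 : K) * R₁ -
        8 * algebraMap K K₃ (b 1 : K) * algebraMap K K₃ (b 6 : K) * R₁ - 16 * algebraMap K K₃ (b 2 : K) * algebraMap K K₃ (b 3 : K) * R₁ -
        8 * algebraMap K K₃ (b 2 : K) * algebraMap K K₃ (b 5 : K) * R₁ - 8 * algebraMap K K₃ (b 2 : K) * algebraMap K K₃ (b 6 : K) * R₂ -
        16 * algebraMap K K₃ (b 2 : K) * algebraMap K K₃ (b 6 : K) * s₃ - 16 * algebraMap K K₃ (b 2 : K) * algebraMap K K₃ (b 7 : K) * R₁ -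
        4 * algebraMap K K₃ (b 2 : K) ^ 2 * s₃ - 8 * algebraMap K K₃ (b 3 : K) * algebraMap K K₃ (b 4 : K) * R₁ -
        16 * algebraMap K K₃ (b 3 : K) * algebraMap K K₃ (b 6 : K) * R₁ - 8 * algebraMap K K₃ (b 4 : K) * algebraMap K K₃ (b 6 : K) * s₃ -
        16 * algebraMap K K₃ (b 4 : K) * algebraMap K K₃ (b 7 : K) * R₁ - 16 * algebraMap K K₃ (b 5 : K) * algebraMap K K₃ (b 6 : K) * R₁ -
        32 * algebraMap K K₃ (b 6 : K) * algebraMap K K₃ (b 7 : K) * R₁ - 8 * algebraMap K K₃ (b 6 : K) ^ 2 * R₂ -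
        8 * algebraMap K K₃ (b 6 : K) ^ 2 * s₃ + 4 * algebraMap K K₃ (a 2 : K) ^ 2 + 8 * algebraMap K K₃ (a 4 : K) * algebraMap K K₃ (a 6 : K) +
        8 * algebraMap K K₃ (a 6 : K) ^ 2 - 8 * algebraMap K K₃ (b 0 : K) * algebraMap K K₃ (b 6 : K) -
        8 * algebraMap K K₃ (b 2 : K) * algebraMap K K₃ (b 4 : K) - 16 * algebraMap K K₃ (b 2 : K) * algebraMap K K₃ (b 6 : K) -
        8 * algebraMap K K₃ (b 2 : K) ^ 2 - 16 * algebraMap K K₃ (b 4 : K) * algebraMap K K₃ (b 6 : K) - 16 * algebraMap K K₃ (b 6 : K) ^ 2) * hR₂ +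
        (-4 * algebraMap K K₃ (b 7 : K) ^ 2 * R₁ ^ 2 * R₂ ^ 2 * s₃ + 4 * algebraMap K K₃ (a 7 : K) ^ 2 * R₁ ^ 2 * R₂ ^ 2 -
        8 * algebraMap K K₃ (b 3 : K) * algebraMap K K₃ (b 7 : K) * R₁ ^ 2 * R₂ ^ 2 -
        8 * algebraMap K K₃ (b 5 : K) * algebraMap K K₃ (b 7 : K) * R₁ ^ 2 * R₂ * s₃ -
        8 * algebraMap K K₃ (b 6 : K) * algebraMap K K₃ (b 7 : K) * R₁ * R₂ ^ 2 * s₃ - 8 * algebraMap K K₃ (b 7 : K) ^ 2 * R₁ ^ 2 * R₂ ^ 2 +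
        8 * algebraMap K K₃ (a 5 : K) * algebraMap K K₃ (a 7 : K) * R₁ ^ 2 * R₂ +
        8 * algebraMap K K₃ (a 6 : K) * algebraMap K K₃ (a 7 : K) * R₁ * R₂ ^ 2 -
        8 * algebraMap K K₃ (b 1 : K) * algebraMap K K₃ (b 7 : K) * R₁ ^ 2 * R₂ -
        8 * algebraMap K K₃ (b 2 : K) * algebraMap K K₃ (b 7 : K) * R₁ * R₂ ^ 2 -
        8 * algebraMap K K₃ (b 3 : K) * algebraMap K K₃ (b 5 : K) * R₁ ^ 2 * R₂ -
        8 * algebraMap K K₃ (b 3 : K) * algebraMap K K₃ (b 6 : K) * R₁ * R₂ ^ 2 -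
        8 * algebraMap K K₃ (b 4 : K) * algebraMap K K₃ (b 7 : K) * R₁ * R₂ * s₃ -
        8 * algebraMap K K₃ (b 5 : K) * algebraMap K K₃ (b 6 : K) * R₁ * R₂ * s₃ -
        16 * algebraMap K K₃ (b 5 : K) * algebraMap K K₃ (b 7 : K) * R₁ ^ 2 * R₂ - 4 * algebraMap K K₃ (b 5 : K) ^ 2 * R₁ ^ 2 * s₃ -
        16 * algebraMap K K₃ (b 6 : K) * algebraMap K K₃ (b 7 : K) * R₁ * R₂ ^ 2 - 4 * algebraMap K K₃ (b 6 : K) ^ 2 * R₂ ^ 2 * s₃ +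
        8 * algebraMap K K₃ (a 4 : K) * algebraMap K K₃ (a 7 : K) * R₁ * R₂ + 8 * algebraMap K K₃ (a 5 : K) * algebraMap K K₃ (a 6 : K) * R₁ * R₂ +
        4 * algebraMap K K₃ (a 5 : K) ^ 2 * R₁ ^ 2 + 4 * algebraMap K K₃ (a 6 : K) ^ 2 * R₂ ^ 2 -
        8 * algebraMap K K₃ (b 0 : K) * algebraMap K K₃ (b 7 : K) * R₁ * R₂ - 8 * algebraMap K K₃ (b 1 : K) * algebraMap K K₃ (b 5 : K) * R₁ ^ 2 -
        8 * algebraMap K K₃ (b 1 : K) * algebraMap K K₃ (b 6 : K) * R₁ * R₂ - 8 * algebraMap K K₃ (b 2 : K) * algebraMap K K₃ (b 5 : K) * R₁ * R₂ -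
        8 * algebraMap K K₃ (b 2 : K) * algebraMap K K₃ (b 6 : K) * R₂ ^ 2 - 8 * algebraMap K K₃ (b 3 : K) * algebraMap K K₃ (b 4 : K) * R₁ * R₂ -
        8 * algebraMap K K₃ (b 4 : K) * algebraMap K K₃ (b 5 : K) * R₁ * s₃ - 8 * algebraMap K K₃ (b 4 : K) * algebraMap K K₃ (b 6 : K) * R₂ * s₃ -
        16 * algebraMap K K₃ (b 4 : K) * algebraMap K K₃ (b 7 : K) * R₁ * R₂ - 16 * algebraMap K K₃ (b 5 : K) * algebraMap K K₃ (b 6 : K) * R₁ * R₂ -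
        8 * algebraMap K K₃ (b 5 : K) ^ 2 * R₁ ^ 2 - 8 * algebraMap K K₃ (b 6 : K) ^ 2 * R₂ ^ 2 +
        8 * algebraMap K K₃ (a 4 : K) * algebraMap K K₃ (a 5 : K) * R₁ + 8 * algebraMap K K₃ (a 4 : K) * algebraMap K K₃ (a 6 : K) * R₂ -
        8 * algebraMap K K₃ (b 0 : K) * algebraMap K K₃ (b 5 : K) * R₁ - 8 * algebraMap K K₃ (b 0 : K) * algebraMap K K₃ (b 6 : K) * R₂ -
        8 * algebraMap K K₃ (b 1 : K) * algebraMap K K₃ (b 4 : K) * R₁ - 8 * algebraMap K K₃ (b 2 : K) * algebraMap K K₃ (b 4 : K) * R₂ -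
        16 * algebraMap K K₃ (b 4 : K) * algebraMap K K₃ (b 5 : K) * R₁ - 16 * algebraMap K K₃ (b 4 : K) * algebraMap K K₃ (b 6 : K) * R₂ -
        4 * algebraMap K K₃ (b 4 : K) ^ 2 * s₃ + 4 * algebraMap K K₃ (a 4 : K) ^ 2 - 8 * algebraMap K K₃ (b 0 : K) * algebraMap K K₃ (b 4 : K) -
        8 * algebraMap K K₃ (b 4 : K) ^ 2) * hR₃ + (4 : K₃) * hg

omit [Algebra K K₁] [IsScalarTower K K₁ K₂] [Algebra K₃ L] [Algebra K L] [IsScalarTower K K₃ L] in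
/-- Step `K₃/K₂`: `C₀` even ⟹ `N_{K₃/K₂}(1 + 4C) = 1 +
      8·D` with `D ∈ B₂` (four coordinates) and `D₀` even. [cite: NeukirchANT1999, Ch. I §2 Prop. (2.6)] -/
theorem exists_norm32_one_add_four_mul [FiniteDimensional K₂ K₃] [IsGalois K₂ K₃] (h3 : Module.finrank K₂ K₃ = 2)
    {s₁ : K₁} (hs₁ : s₁ ^ 2 = 2) {s₂ : K₂} (hs₂ : s₂ ^ 2 = algebraMap K₁ K₂ (2 + s₁)) {s₃ : K₃} (hs₃ : s₃ ^ 2 = algebraMap K₂ K₃ (2 +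
          s₂)) (hs₃K : ∀ x : K₂, algebraMap K₂ K₃ x ≠ s₃)
    (c : Fin 8 → S) (g : S) (hc : c 0 = 2 * g) : ∃ d : Fin 4 → S, ∃ g' : S, d 0 = 2 * g' ∧
    Algebra.norm K₂ (1 + 4 * (algebraMap K K₃ (c 0 : K) + algebraMap K K₃ (c 1 : K) * algebraMap K₁ K₃ s₁ + (algebraMap K K₃ (c 2 : K) +
          algebraMap K K₃ (c 3 : K) * algebraMap K₁ K₃ s₁) * algebraMap K₂ K₃ s₂ + (algebraMap K K₃ (c 4 : K) +
          algebraMap K K₃ (c 5 : K) * algebraMap K₁ K₃ s₁ + (algebraMap K K₃ (c 6 : K) +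
          algebraMap K K₃ (c 7 : K) * algebraMap K₁ K₃ s₁) * algebraMap K₂ K₃ s₂) * s₃)) =
      1 + 8 * (algebraMap K K₂ (d 0 : K) + algebraMap K K₂ (d 1 : K) * algebraMap K₁ K₂ s₁ + (algebraMap K K₂ (d 2 : K) +
            algebraMap K K₂ (d 3 : K) * algebraMap K₁ K₂ s₁) * s₂) := by
  obtain ⟨hQ₁, hQ₂⟩ := rel₂ hs₁ hs₂
  set Q₁ := algebraMap K₁ K₂ s₁ with hQ₁def
  refine ⟨![2 * c 0 ^ 2 + 4 * c 1 ^ 2 + 8 * c 2 * c 3 + 4 * c 2 ^ 2 + 8 * c 3 ^ 2 - 8 * c 4 * c 6 - 8 * c 4 * c 7 - 4 * c 4 ^ 2 - 8 * c 5 * c 6 -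
        16 * c 5 * c 7 - 8 * c 5 ^ 2 - 16 * c 6 * c 7 - 8 * c 6 ^ 2 - 16 * c 7 ^ 2 + 2 * g, 4 * c 0 * c 1 + 8 * c 2 * c 3 + 2 * c 2 ^ 2 +
        4 * c 3 ^ 2 - 8 * c 4 * c 5 - 4 * c 4 * c 6 - 8 * c 4 * c 7 - 8 * c 5 * c 6 - 8 * c 5 * c 7 - 16 * c 6 * c 7 - 4 * c 6 ^ 2 - 8 * c 7 ^ 2 +
        c 1, 4 * c 0 * c 2 + 8 * c 1 * c 3 - 8 * c 4 * c 6 - 2 * c 4 ^ 2 - 16 * c 5 * c 7 - 4 * c 5 ^ 2 - 8 * c 6 * c 7 - 4 * c 6 ^ 2 - 8 * c 7 ^ 2 +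
        c 2, 4 * c 0 * c 3 + 4 * c 1 * c 2 - 4 * c 4 * c 5 - 8 * c 4 * c 7 - 8 * c 5 * c 6 - 8 * c 6 * c 7 - 2 * c 6 ^ 2 - 4 * c 7 ^ 2 +
        c 3], c 0 ^ 2 + 2 * c 1 ^ 2 + 4 * c 2 * c 3 + 2 * c 2 ^ 2 + 4 * c 3 ^ 2 - 4 * c 4 * c 6 - 4 * c 4 * c 7 - 2 * c 4 ^ 2 - 4 * c 5 * c 6 -
        8 * c 5 * c 7 - 4 * c 5 ^ 2 - 8 * c 6 * c 7 - 4 * c 6 ^ 2 - 8 * c 7 ^ 2 + g, by simp only [Matrix.cons_val_zero]; ring, ?_⟩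
  have e : 1 + 4 * (algebraMap K K₃ (c 0 : K) + algebraMap K K₃ (c 1 : K) * algebraMap K₁ K₃ s₁ + (algebraMap K K₃ (c 2 : K) +
        algebraMap K K₃ (c 3 : K) * algebraMap K₁ K₃ s₁) * algebraMap K₂ K₃ s₂ + (algebraMap K K₃ (c 4 : K) +
        algebraMap K K₃ (c 5 : K) * algebraMap K₁ K₃ s₁ + (algebraMap K K₃ (c 6 : K) +
        algebraMap K K₃ (c 7 : K) * algebraMap K₁ K₃ s₁) * algebraMap K₂ K₃ s₂) * s₃) =
      algebraMap K₂ K₃ (1 + 4 * (algebraMap K K₂ (c 0 : K) + algebraMap K K₂ (c 1 : K) * algebraMap K₁ K₂ s₁ + (algebraMap K K₂ (c 2 : K) +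
            algebraMap K K₂ (c 3 : K) * algebraMap K₁ K₂ s₁) * s₂)) +
      algebraMap K₂ K₃ (4 * (algebraMap K K₂ (c 4 : K) + algebraMap K K₂ (c 5 : K) * algebraMap K₁ K₂ s₁ + (algebraMap K K₂ (c 6 : K) +
            algebraMap K K₂ (c 7 : K) * algebraMap K₁ K₂ s₁) * s₂)) * s₃ := by
    simp only [map_add, map_mul, map_one, map_ofNat, ← IsScalarTower.algebraMap_apply]; ring
  rw [e, norm_add_mul_eq_sq_sub_mul_sq h3 hs₃ hs₃K]
  have hgK : ((c 0 : S) : K) = 2 * ((g : S) : K) := by exact_mod_cast hc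
  have hg := congrArg (algebraMap K K₂) hgK
  push_cast [map_ofNat] at hg
  push_cast [Matrix.cons_val_zero, Matrix.cons_val_one, Matrix.cons_val, coe_ofNat_subring, map_ofNat, map_one, map_zero, map_neg, ← hQ₁def]
  linear_combination (-16 * algebraMap K K₂ (c 7 : K) ^ 2 * Q₁ * s₂ + 32 * algebraMap K K₂ (c 1 : K) * algebraMap K K₂ (c 3 : K) * s₂ +
        16 * algebraMap K K₂ (c 3 : K) ^ 2 * Q₁ - 32 * algebraMap K K₂ (c 5 : K) * algebraMap K K₂ (c 7 : K) * Q₁ -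
        64 * algebraMap K K₂ (c 5 : K) * algebraMap K K₂ (c 7 : K) * s₂ - 16 * algebraMap K K₂ (c 5 : K) ^ 2 * s₂ -
        32 * algebraMap K K₂ (c 6 : K) * algebraMap K K₂ (c 7 : K) * s₂ - 32 * algebraMap K K₂ (c 7 : K) ^ 2 * Q₁ -
        32 * algebraMap K K₂ (c 7 : K) ^ 2 * s₂ + 16 * algebraMap K K₂ (c 1 : K) ^ 2 + 32 * algebraMap K K₂ (c 2 : K) * algebraMap K K₂ (c 3 : K) +
        32 * algebraMap K K₂ (c 3 : K) ^ 2 - 32 * algebraMap K K₂ (c 4 : K) * algebraMap K K₂ (c 7 : K) -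
        32 * algebraMap K K₂ (c 5 : K) * algebraMap K K₂ (c 6 : K) - 64 * algebraMap K K₂ (c 5 : K) * algebraMap K K₂ (c 7 : K) -
        32 * algebraMap K K₂ (c 5 : K) ^ 2 - 64 * algebraMap K K₂ (c 6 : K) * algebraMap K K₂ (c 7 : K) - 64 * algebraMap K K₂ (c 7 : K) ^ 2) * hQ₁ +
        (-16 * algebraMap K K₂ (c 7 : K) ^ 2 * Q₁ ^ 2 * s₂ + 16 * algebraMap K K₂ (c 3 : K) ^ 2 * Q₁ ^ 2 -
        32 * algebraMap K K₂ (c 5 : K) * algebraMap K K₂ (c 7 : K) * Q₁ ^ 2 - 32 * algebraMap K K₂ (c 6 : K) * algebraMap K K₂ (c 7 : K) * Q₁ * s₂ -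
        32 * algebraMap K K₂ (c 7 : K) ^ 2 * Q₁ ^ 2 + 32 * algebraMap K K₂ (c 2 : K) * algebraMap K K₂ (c 3 : K) * Q₁ -
        32 * algebraMap K K₂ (c 4 : K) * algebraMap K K₂ (c 7 : K) * Q₁ - 32 * algebraMap K K₂ (c 5 : K) * algebraMap K K₂ (c 6 : K) * Q₁ -
        64 * algebraMap K K₂ (c 6 : K) * algebraMap K K₂ (c 7 : K) * Q₁ - 16 * algebraMap K K₂ (c 6 : K) ^ 2 * s₂ +
        16 * algebraMap K K₂ (c 2 : K) ^ 2 - 32 * algebraMap K K₂ (c 4 : K) * algebraMap K K₂ (c 6 : K) - 32 * algebraMap K K₂ (c 6 : K) ^ 2) * hQ₂ +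
        (8 : K₂) * hg

omit [Algebra K₂ K₃] [Algebra K K₃] [Algebra K₁ K₃] [IsScalarTower K K₂ K₃] [IsScalarTower K₁ K₂ K₃] [Algebra K₃ L] [Algebra K L] [IsScalarTower K K₃ L] in
/-- Step `K₂/K₁`: `D₀` even ⟹ `N_{K₂/K₁}(1 + 8D) = 1 + 16·(e₀ + e₁s₁)` with `e₀` even. [cite: NeukirchANT1999, Ch. I §2 Prop. (2.6)] -/
theorem exists_norm21_one_add_eight_mul [FiniteDimensional K₁ K₂] [IsGalois K₁ K₂] (h2 : Module.finrank K₁ K₂ = 2)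
    {s₁ : K₁} (hs₁ : s₁ ^ 2 = 2) {s₂ : K₂} (hs₂ : s₂ ^ 2 = algebraMap K₁ K₂ (2 + s₁)) (hs₂K : ∀ x : K₁, algebraMap K₁ K₂ x ≠ s₂)
    (d : Fin 4 → S) (g : S) (hd : d 0 = 2 * g) : ∃ e : Fin 2 → S, ∃ g' : S, e 0 = 2 * g' ∧
    Algebra.norm K₁ (1 + 8 * (algebraMap K K₂ (d 0 : K) + algebraMap K K₂ (d 1 : K) * algebraMap K₁ K₂ s₁ + (algebraMap K K₂ (d 2 : K) +
          algebraMap K K₂ (d 3 : K) * algebraMap K₁ K₂ s₁) * s₂)) = 1 + 16 * (algebraMap K K₁ (e 0 : K) + algebraMap K K₁ (e 1 : K) * s₁) := by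
  refine ⟨![4 * d 0 ^ 2 + 8 * d 1 ^ 2 - 16 * d 2 * d 3 - 8 * d 2 ^ 2 - 16 * d 3 ^ 2 + 2 * g, 8 * d 0 * d 1 - 16 * d 2 * d 3 - 4 * d 2 ^ 2 -
        8 * d 3 ^ 2 + d 1], 2 * d 0 ^ 2 + 4 * d 1 ^ 2 - 8 * d 2 * d 3 - 4 * d 2 ^ 2 - 8 * d 3 ^ 2 + g, by simp only [Matrix.cons_val_zero]; ring, ?_⟩
  have e : 1 + 8 * (algebraMap K K₂ (d 0 : K) + algebraMap K K₂ (d 1 : K) * algebraMap K₁ K₂ s₁ + (algebraMap K K₂ (d 2 : K) +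
        algebraMap K K₂ (d 3 : K) * algebraMap K₁ K₂ s₁) * s₂) =
      algebraMap K₁ K₂ (1 + 8 * (algebraMap K K₁ (d 0 : K) + algebraMap K K₁ (d 1 : K) * s₁)) + algebraMap K₁ K₂ (8 * (algebraMap K K₁ (d 2 : K) +
            algebraMap K K₁ (d 3 : K) * s₁)) * s₂ := by
    simp only [map_add, map_mul, map_one, map_ofNat, ← IsScalarTower.algebraMap_apply]; ring
  rw [e, norm_add_mul_eq_sq_sub_mul_sq h2 hs₂ hs₂K]
  have hgK : ((d 0 : S) : K) = 2 * ((g : S) : K) := by exact_mod_cast hd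
  have hg := congrArg (algebraMap K K₁) hgK
  push_cast [map_ofNat] at hg
  push_cast [Matrix.cons_val_zero, Matrix.cons_val_one, Matrix.cons_val, coe_ofNat_subring, map_ofNat, map_one, map_zero, map_neg]
  linear_combination (-64 * algebraMap K K₁ (d 3 : K) ^ 2 * s₁ + 64 * algebraMap K K₁ (d 1 : K) ^ 2 -
        128 * algebraMap K K₁ (d 2 : K) * algebraMap K K₁ (d 3 : K) - 128 * algebraMap K K₁ (d 3 : K) ^ 2) * hs₁ + (16 : K₁) * hg

omit [Algebra K₁ K₂] [Algebra K K₂] [IsScalarTower K K₁ K₂] [Algebra K₂ K₃] [Algebra K K₃] [Algebra K₁ K₃] [IsScalarTower K K₂ K₃] [IsScalarTower K₁ K₂ K₃] [Algebra K₃ L] [Algebra K L] [IsScalarTower K K₃ L] in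
/-- Step `K₁/K`: `e₀ = 2g` ⟹ `N_{K₁/K}(1 + 16(e₀ + e₁s₁)) = (1 + 32g)² − 512e₁² = 1 + 64(g +
      16g² − 8e₁²)`. [cite: NeukirchANT1999, Ch. I §2 Prop. (2.6)] -/
theorem norm10_one_add_sixteen_mul [FiniteDimensional K K₁] [IsGalois K K₁] (h1 : Module.finrank K K₁ = 2)
    {s₁ : K₁} (hs₁ : s₁ ^ 2 = 2) (hs₁K : ∀ k : K, algebraMap K K₁ k ≠ s₁)
    (e : Fin 2 → S) (g : S) (he : e 0 = 2 * g) :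
    Algebra.norm K (1 + 16 * (algebraMap K K₁ (e 0 : K) + algebraMap K K₁ (e 1 : K) * s₁)) = 1 + 64 * ((g + 16 * g ^ 2 - 8 * e 1 ^ 2 : S) : K) := by
  have e' : 1 + 16 * (algebraMap K K₁ (e 0 : K) + algebraMap K K₁ (e 1 : K) * s₁) = algebraMap K K₁ (1 + 16 * (e 0 : K)) +
        algebraMap K K₁ (16 * (e 1 : K)) * s₁ := by
    simp only [map_add, map_mul, map_one, map_ofNat]; ring
  rw [e', Algebra.norm_add_mul_eq_sq_sub_two_mul_sq h1 hs₁ hs₁K]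
  have hgK : ((e 0 : S) : K) = 2 * ((g : S) : K) := by exact_mod_cast he
  push_cast
  linear_combination (32 + 256 * ((e 0 : S) : K) + 512 * ((g : S) : K)) * hgK

/-- ★★ **THE DEEP LEMMA: `N_{L/K}(1 + 2y) ≡ 1 (mod 64)` for every `y = A + B s₄ ∈ B₄`** (the four steps; transitivity of the norm).
(«`N(U^{(16)}_{ℚ₂(ζ₆₄)⁺}) ⊆ U^{(6)}_{ℚ₂}`», Herbrand function of `ℚ₂(ζ₆₄)⁺/ℚ₂`.) [cite: NeukirchANT1999, Ch. I §2 Cor. (2.7) (transitivity of the norm)]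
[cite: NeukirchANT1999, Ch. V §1 (norm group of `ℚ₂(ζ_{2ⁿ})`)] -/
theorem exists_norm_one_add_two_mul [FiniteDimensional K K₁] [IsGalois K K₁] [FiniteDimensional K₁ K₂] [IsGalois K₁ K₂] [FiniteDimensional K₂ K₃] [IsGalois K₂ K₃] [FiniteDimensional K₃ L] [IsGalois K₃ L]
    (h1 : Module.finrank K K₁ = 2) (h2 : Module.finrank K₁ K₂ = 2) (h3 : Module.finrank K₂ K₃ = 2) (h4 : Module.finrank K₃ L = 2)
    {s₁ : K₁} (hs₁ : s₁ ^ 2 = 2) {s₂ : K₂} (hs₂ : s₂ ^ 2 = algebraMap K₁ K₂ (2 + s₁)) {s₃ : K₃} (hs₃ : s₃ ^ 2 = algebraMap K₂ K₃ (2 +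
          s₂)) (hs₁K : ∀ k : K, algebraMap K K₁ k ≠ s₁) (hs₂K : ∀ x : K₁, algebraMap K₁ K₂ x ≠ s₂) (hs₃K : ∀ x : K₂, algebraMap K₂ K₃ x ≠ s₃)
    {s₄ : L} (hs₄ : s₄ ^ 2 = algebraMap K₃ L (2 + s₃)) (hs₄K : ∀ x : K₃, algebraMap K₃ L x ≠ s₄)
    (hdig : ∀ r : S, ∃ q : S, r = 2 * q ∨ r = 1 + 2 * q) (a b : Fin 8 → S) : ∃ q : S,
    Algebra.norm K (1 + 2 * (algebraMap K₃ L (algebraMap K K₃ (a 0 : K) + algebraMap K K₃ (a 1 : K) * algebraMap K₁ K₃ s₁ +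
          (algebraMap K K₃ (a 2 : K) + algebraMap K K₃ (a 3 : K) * algebraMap K₁ K₃ s₁) * algebraMap K₂ K₃ s₂ + (algebraMap K K₃ (a 4 : K) +
          algebraMap K K₃ (a 5 : K) * algebraMap K₁ K₃ s₁ + (algebraMap K K₃ (a 6 : K) +
          algebraMap K K₃ (a 7 : K) * algebraMap K₁ K₃ s₁) * algebraMap K₂ K₃ s₂) * s₃) + algebraMap K₃ L (algebraMap K K₃ (b 0 : K) +
          algebraMap K K₃ (b 1 : K) * algebraMap K₁ K₃ s₁ + (algebraMap K K₃ (b 2 : K) +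
          algebraMap K K₃ (b 3 : K) * algebraMap K₁ K₃ s₁) * algebraMap K₂ K₃ s₂ + (algebraMap K K₃ (b 4 : K) +
          algebraMap K K₃ (b 5 : K) * algebraMap K₁ K₃ s₁ + (algebraMap K K₃ (b 6 : K) +
          algebraMap K K₃ (b 7 : K) * algebraMap K₁ K₃ s₁) * algebraMap K₂ K₃ s₂) * s₃) * s₄)) = 1 + 64 * (q : K) := by
  obtain ⟨c, g₃, hc, e4⟩ := exists_norm43_one_add_two_mul S h4 hs₁ hs₂ hs₃ hs₄ hs₄K hdig a b
  obtain ⟨d, g₂, hd, e3⟩ := exists_norm32_one_add_four_mul S h3 hs₁ hs₂ hs₃ hs₃K c g₃ hc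
  obtain ⟨e, g₁, he, e2⟩ := exists_norm21_one_add_eight_mul S h2 hs₁ hs₂ hs₂K d g₂ hd
  refine ⟨g₁ + 16 * g₁ ^ 2 - 8 * e 1 ^ 2, ?_⟩
  rw [← Algebra.norm_norm (R := K) (S := K₃), e4, ← Algebra.norm_norm (R := K) (S := K₂), e3,
    ← Algebra.norm_norm (R := K) (S := K₁), e2, norm10_one_add_sixteen_mul S h1 hs₁ hs₁K e g₁ he]

/-! ## §4 ★★ The filtration: `N_{L/K}(1 + s₄^j w) ≡ ±1 (mod 64)` for `w ∈ B₄`, by descending induction on `j = 16, …, 1`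

`j = 16`: `s₄^{16} = (2+s₃)^8 = 2·ε` with `ε ∈ ℤ[s₃]`, so the deep lemma applies.  `j → j − 1`... precisely `j +
      1 ⟹ j`: split on the digit of `w`'s constant
coordinate — even: `w = s₄w'`; odd: `w = 1 + s₄w''` and `(1 + s₄^j + s₄^{j+1}w'')(1 − s₄^j) = 1 +
      s₄^{j+1}(w'' − s₄^{j−1} − s₄^j w'')`, where `N(1 − s₄^j) ≡ ±1 (mod 64)`
is one of the fifteen integers of §2. -/

/-- `(2 +
      s₃)^8 = 2·ε` with `ε = (6435, 910, 3944, 60, 3808, 272, 1904, 8) ∈ ℤ[s₃]` (`s₄^{16}/2` is a unit of `ℤ[s₄]`). [cite: Washington1997, §13.1] -/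
theorem two_add_s3_pow_eight {s₁ : K₁} (hs₁ : s₁ ^ 2 = 2) {s₂ : K₂} (hs₂ : s₂ ^ 2 = algebraMap K₁ K₂ (2 +
      s₁)) {s₃ : K₃} (hs₃ : s₃ ^ 2 = algebraMap K₂ K₃ (2 + s₂)) :
    (2 + s₃) ^ 8 = 2 * (6435 + 910 * algebraMap K₁ K₃ s₁ + (3944 + 60 * algebraMap K₁ K₃ s₁) * algebraMap K₂ K₃ s₂ + (3808 +
          272 * algebraMap K₁ K₃ s₁ + (1904 + 8 * algebraMap K₁ K₃ s₁) * algebraMap K₂ K₃ s₂) * s₃) := by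
  obtain ⟨hR₁, hR₂, hR₃⟩ := rel₃ hs₁ hs₂ hs₃
  set R₁ := algebraMap K₁ K₃ s₁ with hR₁def
  set R₂ := algebraMap K₂ K₃ s₂ with hR₂def
  linear_combination (1) * hR₁ + (16 * R₂ * s₃ + R₂ ^ 2 + R₁ + 120 * R₂ + 544 * s₃ + 1818) * hR₂ + (s₃ ^ 6 + R₂ * s₃ ^ 4 + 16 * s₃ ^ 5 +
        16 * R₂ * s₃ ^ 3 + R₂ ^ 2 * s₃ ^ 2 + 114 * s₃ ^ 4 + 116 * R₂ * s₃ ^ 2 + 16 * R₂ ^ 2 * s₃ + R₂ ^ 3 + 480 * s₃ ^ 3 + 512 * R₂ * s₃ +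
        118 * R₂ ^ 2 + 1348 * s₃ ^ 2 + 1580 * R₂ + 2752 * s₃ + 4488) * hR₃

set_option maxHeartbeats 1600000 in
omit [Algebra K K₁] [Algebra K K₂] [IsScalarTower K K₁ K₂] [IsScalarTower K K₂ K₃] in
/-- `s₄^{16} · w = 2 · (ε w)` and `ε w ∈ B₄`. [cite: Washington1997, §13.1] -/
theorem exists_s4_pow_sixteen_mul_eq {s₁ : K₁} (hs₁ : s₁ ^ 2 = 2) {s₂ : K₂} (hs₂ : s₂ ^ 2 = algebraMap K₁ K₂ (2 +
      s₁)) {s₃ : K₃} (hs₃ : s₃ ^ 2 = algebraMap K₂ K₃ (2 + s₂)) {s₄ : L} (hs₄ : s₄ ^ 2 = algebraMap K₃ L (2 + s₃))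
    (a b : Fin 8 → S) : ∃ a' b' : Fin 8 → S,
    s₄ ^ 16 * (algebraMap K₃ L (algebraMap K K₃ (a 0 : K) + algebraMap K K₃ (a 1 : K) * algebraMap K₁ K₃ s₁ + (algebraMap K K₃ (a 2 : K) +
          algebraMap K K₃ (a 3 : K) * algebraMap K₁ K₃ s₁) * algebraMap K₂ K₃ s₂ + (algebraMap K K₃ (a 4 : K) +
          algebraMap K K₃ (a 5 : K) * algebraMap K₁ K₃ s₁ + (algebraMap K K₃ (a 6 : K) +
          algebraMap K K₃ (a 7 : K) * algebraMap K₁ K₃ s₁) * algebraMap K₂ K₃ s₂) * s₃) + algebraMap K₃ L (algebraMap K K₃ (b 0 : K) +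
          algebraMap K K₃ (b 1 : K) * algebraMap K₁ K₃ s₁ + (algebraMap K K₃ (b 2 : K) +
          algebraMap K K₃ (b 3 : K) * algebraMap K₁ K₃ s₁) * algebraMap K₂ K₃ s₂ + (algebraMap K K₃ (b 4 : K) +
          algebraMap K K₃ (b 5 : K) * algebraMap K₁ K₃ s₁ + (algebraMap K K₃ (b 6 : K) +
          algebraMap K K₃ (b 7 : K) * algebraMap K₁ K₃ s₁) * algebraMap K₂ K₃ s₂) * s₃) * s₄) =
      2 * (algebraMap K₃ L (algebraMap K K₃ (a' 0 : K) + algebraMap K K₃ (a' 1 : K) * algebraMap K₁ K₃ s₁ + (algebraMap K K₃ (a' 2 : K) +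
            algebraMap K K₃ (a' 3 : K) * algebraMap K₁ K₃ s₁) * algebraMap K₂ K₃ s₂ + (algebraMap K K₃ (a' 4 : K) +
            algebraMap K K₃ (a' 5 : K) * algebraMap K₁ K₃ s₁ + (algebraMap K K₃ (a' 6 : K) +
            algebraMap K K₃ (a' 7 : K) * algebraMap K₁ K₃ s₁) * algebraMap K₂ K₃ s₂) * s₃) + algebraMap K₃ L (algebraMap K K₃ (b' 0 : K) +
            algebraMap K K₃ (b' 1 : K) * algebraMap K₁ K₃ s₁ + (algebraMap K K₃ (b' 2 : K) +
            algebraMap K K₃ (b' 3 : K) * algebraMap K₁ K₃ s₁) * algebraMap K₂ K₃ s₂ + (algebraMap K K₃ (b' 4 : K) +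
            algebraMap K K₃ (b' 5 : K) * algebraMap K₁ K₃ s₁ + (algebraMap K K₃ (b' 6 : K) +
            algebraMap K K₃ (b' 7 : K) * algebraMap K₁ K₃ s₁) * algebraMap K₂ K₃ s₂) * s₃) * s₄) := by
  obtain ⟨hT₁, hT₂, hT₃, hT₄⟩ := rel₄ hs₁ hs₂ hs₃ hs₄
  set T₁ := algebraMap K₃ L (algebraMap K₁ K₃ s₁) with hT₁def
  set T₂ := algebraMap K₃ L (algebraMap K₂ K₃ s₂) with hT₂def
  set T₃ := algebraMap K₃ L s₃ with hT₃def
  refine ⟨![6435 * a 0 + 1820 * a 1 + 8008 * a 2 + 8128 * a 3 + 11440 * a 4 + 4928 * a 5 + 15808 * a 6 + 16384 * a 7, 910 * a 0 + 6435 * a 1 +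
        4064 * a 2 + 8008 * a 3 + 2464 * a 4 + 11440 * a 5 + 8192 * a 6 + 15808 * a 7, 3944 * a 0 + 120 * a 1 + 6435 * a 2 + 1820 * a 3 +
        7616 * a 4 + 576 * a 5 + 11440 * a 6 + 4928 * a 7, 60 * a 0 + 3944 * a 1 + 910 * a 2 + 6435 * a 3 + 288 * a 4 + 7616 * a 5 + 2464 * a 6 +
        11440 * a 7, 3808 * a 0 + 544 * a 1 + 3824 * a 2 + 3840 * a 3 + 6435 * a 4 + 1820 * a 5 + 8008 * a 6 + 8128 * a 7, 272 * a 0 + 3808 * a 1 +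
        1920 * a 2 + 3824 * a 3 + 910 * a 4 + 6435 * a 5 + 4064 * a 6 + 8008 * a 7, 1904 * a 0 + 16 * a 1 + 3808 * a 2 + 544 * a 3 + 3944 * a 4 +
        120 * a 5 + 6435 * a 6 + 1820 * a 7, 8 * a 0 + 1904 * a 1 + 272 * a 2 + 3808 * a 3 + 60 * a 4 + 3944 * a 5 + 910 * a 6 + 6435 * a 7],
    ![6435 * b 0 + 1820 * b 1 + 8008 * b 2 + 8128 * b 3 + 11440 * b 4 + 4928 * b 5 + 15808 * b 6 + 16384 * b 7, 910 * b 0 + 6435 * b 1 + 4064 * b 2 +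
          8008 * b 3 + 2464 * b 4 + 11440 * b 5 + 8192 * b 6 + 15808 * b 7, 3944 * b 0 + 120 * b 1 + 6435 * b 2 + 1820 * b 3 + 7616 * b 4 +
          576 * b 5 + 11440 * b 6 + 4928 * b 7, 60 * b 0 + 3944 * b 1 + 910 * b 2 + 6435 * b 3 + 288 * b 4 + 7616 * b 5 + 2464 * b 6 +
          11440 * b 7, 3808 * b 0 + 544 * b 1 + 3824 * b 2 + 3840 * b 3 + 6435 * b 4 + 1820 * b 5 + 8008 * b 6 + 8128 * b 7, 272 * b 0 + 3808 * b 1 +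
          1920 * b 2 + 3824 * b 3 + 910 * b 4 + 6435 * b 5 + 4064 * b 6 + 8008 * b 7, 1904 * b 0 + 16 * b 1 + 3808 * b 2 + 544 * b 3 + 3944 * b 4 +
          120 * b 5 + 6435 * b 6 + 1820 * b 7, 8 * b 0 + 1904 * b 1 + 272 * b 2 + 3808 * b 3 + 60 * b 4 + 3944 * b 5 + 910 * b 6 + 6435 * b 7], ?_⟩
  rw [show s₄ ^ 16 = (s₄ ^ 2) ^ 8 by ring, hs₄, ← map_pow, two_add_s3_pow_eight hs₁ hs₂ hs₃]
  push_cast [Matrix.cons_val_zero, Matrix.cons_val_one, Matrix.cons_val, coe_ofNat_subring, map_ofNat, map_one, map_zero, map_neg, ← IsScalarTower.algebraMap_apply, ← hT₁def, ← hT₂def, ← hT₃def]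
  linear_combination (16 * algebraMap K L (b 1 : K) * T₂ * T₃ * s₄ + 16 * algebraMap K L (b 3 : K) * T₁ * T₃ * s₄ +
        544 * algebraMap K L (b 3 : K) * T₂ * T₃ * s₄ + 120 * algebraMap K L (b 5 : K) * T₂ * T₃ * s₄ +
        16 * algebraMap K L (b 7 : K) * T₁ * T₂ * s₄ + 120 * algebraMap K L (b 7 : K) * T₁ * T₃ * s₄ +
        1820 * algebraMap K L (b 7 : K) * T₂ * T₃ * s₄ + 16 * algebraMap K L (a 1 : K) * T₂ * T₃ + 16 * algebraMap K L (a 3 : K) * T₁ * T₃ +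
        544 * algebraMap K L (a 3 : K) * T₂ * T₃ + 120 * algebraMap K L (a 5 : K) * T₂ * T₃ + 16 * algebraMap K L (a 7 : K) * T₁ * T₂ +
        120 * algebraMap K L (a 7 : K) * T₁ * T₃ + 1820 * algebraMap K L (a 7 : K) * T₂ * T₃ + 120 * algebraMap K L (b 1 : K) * T₂ * s₄ +
        544 * algebraMap K L (b 1 : K) * T₃ * s₄ + 16 * algebraMap K L (b 2 : K) * T₃ * s₄ + 120 * algebraMap K L (b 3 : K) * T₁ * s₄ +
        1820 * algebraMap K L (b 3 : K) * T₂ * s₄ + 3840 * algebraMap K L (b 3 : K) * T₃ * s₄ + 16 * algebraMap K L (b 5 : K) * T₁ * s₄ +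
        576 * algebraMap K L (b 5 : K) * T₂ * s₄ + 1820 * algebraMap K L (b 5 : K) * T₃ * s₄ + 16 * algebraMap K L (b 6 : K) * T₂ * s₄ +
        120 * algebraMap K L (b 6 : K) * T₃ * s₄ + 576 * algebraMap K L (b 7 : K) * T₁ * s₄ + 4928 * algebraMap K L (b 7 : K) * T₂ * s₄ +
        8128 * algebraMap K L (b 7 : K) * T₃ * s₄ + 120 * algebraMap K L (a 1 : K) * T₂ + 544 * algebraMap K L (a 1 : K) * T₃ +
        16 * algebraMap K L (a 2 : K) * T₃ + 120 * algebraMap K L (a 3 : K) * T₁ + 1820 * algebraMap K L (a 3 : K) * T₂ +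
        3840 * algebraMap K L (a 3 : K) * T₃ + 16 * algebraMap K L (a 5 : K) * T₁ + 576 * algebraMap K L (a 5 : K) * T₂ +
        1820 * algebraMap K L (a 5 : K) * T₃ + 16 * algebraMap K L (a 6 : K) * T₂ + 120 * algebraMap K L (a 6 : K) * T₃ +
        576 * algebraMap K L (a 7 : K) * T₁ + 4928 * algebraMap K L (a 7 : K) * T₂ + 8128 * algebraMap K L (a 7 : K) * T₃ +
        1820 * algebraMap K L (b 1 : K) * s₄ + 120 * algebraMap K L (b 2 : K) * s₄ + 8128 * algebraMap K L (b 3 : K) * s₄ +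
        16 * algebraMap K L (b 4 : K) * s₄ + 4928 * algebraMap K L (b 5 : K) * s₄ + 576 * algebraMap K L (b 6 : K) * s₄ +
        16384 * algebraMap K L (b 7 : K) * s₄ + 1820 * algebraMap K L (a 1 : K) + 120 * algebraMap K L (a 2 : K) + 8128 * algebraMap K L (a 3 : K) +
        16 * algebraMap K L (a 4 : K) + 4928 * algebraMap K L (a 5 : K) + 576 * algebraMap K L (a 6 : K) + 16384 * algebraMap K L (a 7 : K)) * hT₁ +
        (16 * algebraMap K L (b 3 : K) * T₁ ^ 2 * T₃ * s₄ + 16 * algebraMap K L (b 7 : K) * T₁ ^ 2 * T₂ * s₄ +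
        120 * algebraMap K L (b 7 : K) * T₁ ^ 2 * T₃ * s₄ + 16 * algebraMap K L (a 3 : K) * T₁ ^ 2 * T₃ +
        16 * algebraMap K L (a 7 : K) * T₁ ^ 2 * T₂ + 120 * algebraMap K L (a 7 : K) * T₁ ^ 2 * T₃ + 16 * algebraMap K L (b 2 : K) * T₁ * T₃ * s₄ +
        3808 * algebraMap K L (b 3 : K) * T₁ * T₃ * s₄ + 120 * algebraMap K L (b 3 : K) * T₁ ^ 2 * s₄ + 16 * algebraMap K L (b 5 : K) * T₁ ^ 2 * s₄ +
        16 * algebraMap K L (b 6 : K) * T₁ * T₂ * s₄ + 120 * algebraMap K L (b 6 : K) * T₁ * T₃ * s₄ +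
        3808 * algebraMap K L (b 7 : K) * T₁ * T₂ * s₄ + 7888 * algebraMap K L (b 7 : K) * T₁ * T₃ * s₄ +
        576 * algebraMap K L (b 7 : K) * T₁ ^ 2 * s₄ + 16 * algebraMap K L (a 2 : K) * T₁ * T₃ + 3808 * algebraMap K L (a 3 : K) * T₁ * T₃ +
        120 * algebraMap K L (a 3 : K) * T₁ ^ 2 + 16 * algebraMap K L (a 5 : K) * T₁ ^ 2 + 16 * algebraMap K L (a 6 : K) * T₁ * T₂ +
        120 * algebraMap K L (a 6 : K) * T₁ * T₃ + 3808 * algebraMap K L (a 7 : K) * T₁ * T₂ + 7888 * algebraMap K L (a 7 : K) * T₁ * T₃ +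
        576 * algebraMap K L (a 7 : K) * T₁ ^ 2 + 120 * algebraMap K L (b 2 : K) * T₁ * s₄ + 3808 * algebraMap K L (b 2 : K) * T₃ * s₄ +
        7888 * algebraMap K L (b 3 : K) * T₁ * s₄ + 16 * algebraMap K L (b 4 : K) * T₁ * s₄ + 3808 * algebraMap K L (b 5 : K) * T₁ * s₄ +
        576 * algebraMap K L (b 6 : K) * T₁ * s₄ + 3808 * algebraMap K L (b 6 : K) * T₂ * s₄ + 7888 * algebraMap K L (b 6 : K) * T₃ * s₄ +
        15232 * algebraMap K L (b 7 : K) * T₁ * s₄ + 120 * algebraMap K L (a 2 : K) * T₁ + 3808 * algebraMap K L (a 2 : K) * T₃ +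
        7888 * algebraMap K L (a 3 : K) * T₁ + 16 * algebraMap K L (a 4 : K) * T₁ + 3808 * algebraMap K L (a 5 : K) * T₁ +
        576 * algebraMap K L (a 6 : K) * T₁ + 3808 * algebraMap K L (a 6 : K) * T₂ + 7888 * algebraMap K L (a 6 : K) * T₃ +
        15232 * algebraMap K L (a 7 : K) * T₁ + 7888 * algebraMap K L (b 2 : K) * s₄ + 3808 * algebraMap K L (b 4 : K) * s₄ +
        15232 * algebraMap K L (b 6 : K) * s₄ + 7888 * algebraMap K L (a 2 : K) + 3808 * algebraMap K L (a 4 : K) +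
        15232 * algebraMap K L (a 6 : K)) * hT₂ + (16 * algebraMap K L (b 7 : K) * T₁ ^ 2 * T₂ ^ 2 * s₄ +
        16 * algebraMap K L (a 7 : K) * T₁ ^ 2 * T₂ ^ 2 + 16 * algebraMap K L (b 5 : K) * T₁ ^ 2 * T₂ * s₄ +
        16 * algebraMap K L (b 6 : K) * T₁ * T₂ ^ 2 * s₄ + 3808 * algebraMap K L (b 7 : K) * T₁ * T₂ ^ 2 * s₄ +
        544 * algebraMap K L (b 7 : K) * T₁ ^ 2 * T₂ * s₄ + 16 * algebraMap K L (a 5 : K) * T₁ ^ 2 * T₂ +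
        16 * algebraMap K L (a 6 : K) * T₁ * T₂ ^ 2 + 3808 * algebraMap K L (a 7 : K) * T₁ * T₂ ^ 2 + 544 * algebraMap K L (a 7 : K) * T₁ ^ 2 * T₂ +
        16 * algebraMap K L (b 4 : K) * T₁ * T₂ * s₄ + 3808 * algebraMap K L (b 5 : K) * T₁ * T₂ * s₄ +
        544 * algebraMap K L (b 5 : K) * T₁ ^ 2 * s₄ + 544 * algebraMap K L (b 6 : K) * T₁ * T₂ * s₄ +
        3808 * algebraMap K L (b 6 : K) * T₂ ^ 2 * s₄ + 7616 * algebraMap K L (b 7 : K) * T₁ * T₂ * s₄ + 16 * algebraMap K L (a 4 : K) * T₁ * T₂ +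
        3808 * algebraMap K L (a 5 : K) * T₁ * T₂ + 544 * algebraMap K L (a 5 : K) * T₁ ^ 2 + 544 * algebraMap K L (a 6 : K) * T₁ * T₂ +
        3808 * algebraMap K L (a 6 : K) * T₂ ^ 2 + 7616 * algebraMap K L (a 7 : K) * T₁ * T₂ + 544 * algebraMap K L (b 4 : K) * T₁ * s₄ +
        3808 * algebraMap K L (b 4 : K) * T₂ * s₄ + 7616 * algebraMap K L (b 5 : K) * T₁ * s₄ + 7616 * algebraMap K L (b 6 : K) * T₂ * s₄ +
        544 * algebraMap K L (a 4 : K) * T₁ + 3808 * algebraMap K L (a 4 : K) * T₂ + 7616 * algebraMap K L (a 5 : K) * T₁ +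
        7616 * algebraMap K L (a 6 : K) * T₂ + 7616 * algebraMap K L (b 4 : K) * s₄ + 7616 * algebraMap K L (a 4 : K)) * hT₃

/-- ★★ **THE FILTRATION: `N_{L/K}(1 + s₄^j·w) ≡ ±1 (mod 64)` for every `w ∈ B₄` and `1 ≤ j ≤ 16`** (stated with `j = 16 − n`, `n ≤ 15`; descending
induction).  [cite: NeukirchANT1999, Ch. V §1 (norm group of `ℚ₂(ζ_{2ⁿ})`)] [cite: NeukirchANT1999, Ch. II §5 (the filtration `U^{(j)}` of a local unit group)] -/
theorem exists_norm_one_add_s4_pow_mul [FiniteDimensional K K₁] [IsGalois K K₁] [FiniteDimensional K₁ K₂] [IsGalois K₁ K₂] [FiniteDimensional K₂ K₃] [IsGalois K₂ K₃] [FiniteDimensional K₃ L] [IsGalois K₃ L]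
    (h1 : Module.finrank K K₁ = 2) (h2 : Module.finrank K₁ K₂ = 2) (h3 : Module.finrank K₂ K₃ = 2) (h4 : Module.finrank K₃ L = 2)
    {s₁ : K₁} (hs₁ : s₁ ^ 2 = 2) {s₂ : K₂} (hs₂ : s₂ ^ 2 = algebraMap K₁ K₂ (2 + s₁)) {s₃ : K₃} (hs₃ : s₃ ^ 2 = algebraMap K₂ K₃ (2 +
          s₂)) (hs₁K : ∀ k : K, algebraMap K K₁ k ≠ s₁) (hs₂K : ∀ x : K₁, algebraMap K₁ K₂ x ≠ s₂) (hs₃K : ∀ x : K₂, algebraMap K₂ K₃ x ≠ s₃)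
    {s₄ : L} (hs₄ : s₄ ^ 2 = algebraMap K₃ L (2 + s₃)) (hs₄K : ∀ x : K₃, algebraMap K₃ L x ≠ s₄)
    (hdig : ∀ r : S, ∃ q : S, r = 2 * q ∨ r = 1 + 2 * q) (n : ℕ) (hn : n ≤ 15) :
    ∀ a b : Fin 8 → S, ∃ σ : ℤ, ∃ q : S, (σ = 1 ∨ σ = -1) ∧
      Algebra.norm K (1 + s₄ ^ (16 - n) * (algebraMap K₃ L (algebraMap K K₃ (a 0 : K) + algebraMap K K₃ (a 1 : K) * algebraMap K₁ K₃ s₁ +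
            (algebraMap K K₃ (a 2 : K) + algebraMap K K₃ (a 3 : K) * algebraMap K₁ K₃ s₁) * algebraMap K₂ K₃ s₂ + (algebraMap K K₃ (a 4 : K) +
            algebraMap K K₃ (a 5 : K) * algebraMap K₁ K₃ s₁ + (algebraMap K K₃ (a 6 : K) +
            algebraMap K K₃ (a 7 : K) * algebraMap K₁ K₃ s₁) * algebraMap K₂ K₃ s₂) * s₃) + algebraMap K₃ L (algebraMap K K₃ (b 0 : K) +
            algebraMap K K₃ (b 1 : K) * algebraMap K₁ K₃ s₁ + (algebraMap K K₃ (b 2 : K) +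
            algebraMap K K₃ (b 3 : K) * algebraMap K₁ K₃ s₁) * algebraMap K₂ K₃ s₂ + (algebraMap K K₃ (b 4 : K) +
            algebraMap K K₃ (b 5 : K) * algebraMap K₁ K₃ s₁ + (algebraMap K K₃ (b 6 : K) +
            algebraMap K K₃ (b 7 : K) * algebraMap K₁ K₃ s₁) * algebraMap K₂ K₃ s₂) * s₃) * s₄)) = (σ : K) + 64 * (q : K) := by
  induction n with
  | zero =>
    intro a b
    obtain ⟨a', b', h16⟩ := exists_s4_pow_sixteen_mul_eq S hs₁ hs₂ hs₃ hs₄ a b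
    obtain ⟨q, hq⟩ := exists_norm_one_add_two_mul S h1 h2 h3 h4 hs₁ hs₂ hs₃ hs₁K hs₂K hs₃K hs₄ hs₄K hdig a' b'
    exact ⟨1, q, Or.inl rfl, by rw [Nat.sub_zero, h16, hq]; push_cast; ring⟩
  | succ n ih =>
    intro a b
    have hn' : n ≤ 15 := by omega
    obtain ⟨i, hi⟩ : ∃ i : ℕ, n + i = 14 := ⟨14 - n, by omega⟩
    have hi1 : 16 - (n + 1) = i + 1 := by omega
    have hi2 : 16 - n = i + 2 := by omega
    obtain ⟨hT₁, hT₂, hT₃, hT₄⟩ := rel₄ hs₁ hs₂ hs₃ hs₄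
    set T₁ := algebraMap K₃ L (algebraMap K₁ K₃ s₁) with hT₁def
    set T₂ := algebraMap K₃ L (algebraMap K₂ K₃ s₂) with hT₂def
    set T₃ := algebraMap K₃ L s₃ with hT₃def
    obtain ⟨e, ha | ha⟩ := hdig (a 0)
    · -- even constant coordinate: `w = s₄ w'`
      obtain ⟨a', b', h⟩ := exists_eq_s4_mul_of_even S hs₁ hs₂ hs₃ hs₄ a b e ha
      obtain ⟨σ, q, hσ, hN⟩ := ih hn' a' b'
      refine ⟨σ, q, hσ, ?_⟩
      rw [h, ← mul_assoc, ← pow_succ, hi1, show i + 1 + 1 = i + 2 from rfl]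
      rw [hi2] at hN
      exact hN
    · -- odd constant coordinate: `w = 1 + s₄ w''`
      have hsplit : algebraMap K₃ L (algebraMap K K₃ (a 0 : K) + algebraMap K K₃ (a 1 : K) * algebraMap K₁ K₃ s₁ + (algebraMap K K₃ (a 2 : K) +
            algebraMap K K₃ (a 3 : K) * algebraMap K₁ K₃ s₁) * algebraMap K₂ K₃ s₂ + (algebraMap K K₃ (a 4 : K) +
            algebraMap K K₃ (a 5 : K) * algebraMap K₁ K₃ s₁ + (algebraMap K K₃ (a 6 : K) +
            algebraMap K K₃ (a 7 : K) * algebraMap K₁ K₃ s₁) * algebraMap K₂ K₃ s₂) * s₃) + algebraMap K₃ L (algebraMap K K₃ (b 0 : K) +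
            algebraMap K K₃ (b 1 : K) * algebraMap K₁ K₃ s₁ + (algebraMap K K₃ (b 2 : K) +
            algebraMap K K₃ (b 3 : K) * algebraMap K₁ K₃ s₁) * algebraMap K₂ K₃ s₂ + (algebraMap K K₃ (b 4 : K) +
            algebraMap K K₃ (b 5 : K) * algebraMap K₁ K₃ s₁ + (algebraMap K K₃ (b 6 : K) +
            algebraMap K K₃ (b 7 : K) * algebraMap K₁ K₃ s₁) * algebraMap K₂ K₃ s₂) * s₃) * s₄ =
          1 + (algebraMap K₃ L (algebraMap K K₃ (![2 * e, a 1, a 2, a 3, a 4, a 5, a 6, a 7] 0 : K) +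
                algebraMap K K₃ (![2 * e, a 1, a 2, a 3, a 4, a 5, a 6, a 7] 1 : K) * algebraMap K₁ K₃ s₁ +
                (algebraMap K K₃ (![2 * e, a 1, a 2, a 3, a 4, a 5, a 6, a 7] 2 : K) +
                algebraMap K K₃ (![2 * e, a 1, a 2, a 3, a 4, a 5, a 6, a 7] 3 : K) * algebraMap K₁ K₃ s₁) * algebraMap K₂ K₃ s₂ +
                (algebraMap K K₃ (![2 * e, a 1, a 2, a 3, a 4, a 5, a 6, a 7] 4 : K) +
                algebraMap K K₃ (![2 * e, a 1, a 2, a 3, a 4, a 5, a 6, a 7] 5 : K) * algebraMap K₁ K₃ s₁ +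
                (algebraMap K K₃ (![2 * e, a 1, a 2, a 3, a 4, a 5, a 6, a 7] 6 : K) +
                algebraMap K K₃ (![2 * e, a 1, a 2, a 3, a 4, a 5, a 6, a 7] 7 : K) * algebraMap K₁ K₃ s₁) * algebraMap K₂ K₃ s₂) * s₃) +
                algebraMap K₃ L (algebraMap K K₃ (b 0 : K) + algebraMap K K₃ (b 1 : K) * algebraMap K₁ K₃ s₁ + (algebraMap K K₃ (b 2 : K) +
                algebraMap K K₃ (b 3 : K) * algebraMap K₁ K₃ s₁) * algebraMap K₂ K₃ s₂ + (algebraMap K K₃ (b 4 : K) +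
                algebraMap K K₃ (b 5 : K) * algebraMap K₁ K₃ s₁ + (algebraMap K K₃ (b 6 : K) +
                algebraMap K K₃ (b 7 : K) * algebraMap K₁ K₃ s₁) * algebraMap K₂ K₃ s₂) * s₃) * s₄) := by
        rw [ha]
        push_cast [Matrix.cons_val_zero, Matrix.cons_val_one, Matrix.cons_val, coe_ofNat_subring, map_ofNat, map_one, map_zero, map_neg, ← IsScalarTower.algebraMap_apply, ← hT₁def, ← hT₂def, ← hT₃def]
        ring
      obtain ⟨a₁, b₁, h₁⟩ := exists_eq_s4_mul_of_even S hs₁ hs₂ hs₃ hs₄ ![2 * e, a 1, a 2, a 3, a 4, a 5, a 6, a 7] b e rfl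
      obtain ⟨a₂, b₂, h₂⟩ := exists_s4_pow_eq S hs₁ hs₂ hs₃ hs₄ i
      obtain ⟨a₃, b₃, h₃⟩ := exists_s4_pow_mul_eq S hs₁ hs₂ hs₃ hs₄ (i + 1) a₁ b₁
      obtain ⟨a₄, b₄, h₄⟩ := exists_sub_sub_eq S hs₁ hs₂ hs₃ hs₄ a₁ b₁ a₂ b₂ a₃ b₃
      obtain ⟨σ, q, hσ, hN⟩ := ih hn' a₄ b₄
      rw [hi2] at hN
      obtain ⟨σ', k, hσ', hN'⟩ := exists_norm_one_sub_s4_pow h1 h2 h3 h4 hs₁ hs₂ hs₃ hs₁K hs₂K hs₃K hs₄ hs₄K (i + 1) (by omega) (by omega)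
      obtain ⟨a₅, b₅, h₅⟩ := exists_s4_pow_mul_eq S hs₁ hs₂ hs₃ hs₄ (i + 1) a b
      obtain ⟨a₆, b₆, h₆⟩ := exists_one_add_eq S hs₁ hs₂ hs₃ hs₄ a₅ b₅
      obtain ⟨nX, hnX⟩ := exists_norm_eq_coe S h1 h2 h3 h4 hs₁ hs₂ hs₃ hs₁K hs₂K hs₃K hs₄ hs₄K a₆ b₆
      rw [hi1]
      have hX : Algebra.norm K (1 + s₄ ^ (i + 1) * (algebraMap K₃ L (algebraMap K K₃ (a 0 : K) + algebraMap K K₃ (a 1 : K) * algebraMap K₁ K₃ s₁ +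
            (algebraMap K K₃ (a 2 : K) + algebraMap K K₃ (a 3 : K) * algebraMap K₁ K₃ s₁) * algebraMap K₂ K₃ s₂ + (algebraMap K K₃ (a 4 : K) +
            algebraMap K K₃ (a 5 : K) * algebraMap K₁ K₃ s₁ + (algebraMap K K₃ (a 6 : K) +
            algebraMap K K₃ (a 7 : K) * algebraMap K₁ K₃ s₁) * algebraMap K₂ K₃ s₂) * s₃) + algebraMap K₃ L (algebraMap K K₃ (b 0 : K) +
            algebraMap K K₃ (b 1 : K) * algebraMap K₁ K₃ s₁ + (algebraMap K K₃ (b 2 : K) +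
            algebraMap K K₃ (b 3 : K) * algebraMap K₁ K₃ s₁) * algebraMap K₂ K₃ s₂ + (algebraMap K K₃ (b 4 : K) +
            algebraMap K K₃ (b 5 : K) * algebraMap K₁ K₃ s₁ + (algebraMap K K₃ (b 6 : K) +
            algebraMap K K₃ (b 7 : K) * algebraMap K₁ K₃ s₁) * algebraMap K₂ K₃ s₂) * s₃) * s₄)) = (nX : K) := by
        rw [h₅, h₆, hnX]
      have key : (1 + s₄ ^ (i + 1) * (algebraMap K₃ L (algebraMap K K₃ (a 0 : K) + algebraMap K K₃ (a 1 : K) * algebraMap K₁ K₃ s₁ +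
            (algebraMap K K₃ (a 2 : K) + algebraMap K K₃ (a 3 : K) * algebraMap K₁ K₃ s₁) * algebraMap K₂ K₃ s₂ + (algebraMap K K₃ (a 4 : K) +
            algebraMap K K₃ (a 5 : K) * algebraMap K₁ K₃ s₁ + (algebraMap K K₃ (a 6 : K) +
            algebraMap K K₃ (a 7 : K) * algebraMap K₁ K₃ s₁) * algebraMap K₂ K₃ s₂) * s₃) + algebraMap K₃ L (algebraMap K K₃ (b 0 : K) +
            algebraMap K K₃ (b 1 : K) * algebraMap K₁ K₃ s₁ + (algebraMap K K₃ (b 2 : K) +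
            algebraMap K K₃ (b 3 : K) * algebraMap K₁ K₃ s₁) * algebraMap K₂ K₃ s₂ + (algebraMap K K₃ (b 4 : K) +
            algebraMap K K₃ (b 5 : K) * algebraMap K₁ K₃ s₁ + (algebraMap K K₃ (b 6 : K) +
            algebraMap K K₃ (b 7 : K) * algebraMap K₁ K₃ s₁) * algebraMap K₂ K₃ s₂) * s₃) * s₄)) * (1 - s₄ ^ (i + 1)) =
          1 + s₄ ^ (i + 2) * (algebraMap K₃ L (algebraMap K K₃ (a₄ 0 : K) + algebraMap K K₃ (a₄ 1 : K) * algebraMap K₁ K₃ s₁ +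
                (algebraMap K K₃ (a₄ 2 : K) + algebraMap K K₃ (a₄ 3 : K) * algebraMap K₁ K₃ s₁) * algebraMap K₂ K₃ s₂ + (algebraMap K K₃ (a₄ 4 : K) +
                algebraMap K K₃ (a₄ 5 : K) * algebraMap K₁ K₃ s₁ + (algebraMap K K₃ (a₄ 6 : K) +
                algebraMap K K₃ (a₄ 7 : K) * algebraMap K₁ K₃ s₁) * algebraMap K₂ K₃ s₂) * s₃) + algebraMap K₃ L (algebraMap K K₃ (b₄ 0 : K) +
                algebraMap K K₃ (b₄ 1 : K) * algebraMap K₁ K₃ s₁ + (algebraMap K K₃ (b₄ 2 : K) +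
                algebraMap K K₃ (b₄ 3 : K) * algebraMap K₁ K₃ s₁) * algebraMap K₂ K₃ s₂ + (algebraMap K K₃ (b₄ 4 : K) +
                algebraMap K K₃ (b₄ 5 : K) * algebraMap K₁ K₃ s₁ + (algebraMap K K₃ (b₄ 6 : K) +
                algebraMap K K₃ (b₄ 7 : K) * algebraMap K₁ K₃ s₁) * algebraMap K₂ K₃ s₂) * s₃) * s₄) := by
        rw [← h₄, ← h₃, ← h₂, hsplit, h₁]
        ring
      have hmul : (nX : K) * ((σ' : K) + 64 * (k : K)) = (σ : K) + 64 * (q : K) := by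
        rw [← hX, ← hN', ← map_mul, key, hN]
      rcases hσ with rfl | rfl <;> rcases hσ' with rfl | rfl
      · exact ⟨1, q - k * nX, Or.inl rfl, by rw [hX]; push_cast at hmul ⊢; linear_combination hmul⟩
      · exact ⟨-1, k * nX - q, Or.inr rfl, by rw [hX]; push_cast at hmul ⊢; linear_combination -hmul⟩
      · exact ⟨-1, q - k * nX, Or.inr rfl, by rw [hX]; push_cast at hmul ⊢; linear_combination hmul⟩
      · exact ⟨1, k * nX - q, Or.inl rfl, by rw [hX]; push_cast at hmul ⊢; linear_combination -hmul⟩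

/-! ## §5 ★★★ Units of `B₄` have norm `≡ ±1 (mod 64)`; descent by `s₄`; THE LEVEL-`64` LEMMA -/

omit [Algebra K₁ K₃] [IsScalarTower K₁ K₂ K₃] in
/-- `[L : K] = 16`. [cite: NeukirchANT1999, Ch. I §2 (the tower law)] -/
theorem finrank_eq_sixteen (h1 : Module.finrank K K₁ = 2) (h2 : Module.finrank K₁ K₂ = 2) (h3 : Module.finrank K₂ K₃ = 2) (h4 : Module.finrank K₃ L = 2) : Module.finrank K L = 16 := by
  rw [← Module.finrank_mul_finrank K K₃ L, ← Module.finrank_mul_finrank K K₂ K₃, ← Module.finrank_mul_finrank K K₁ K₂, h1, h2, h3, h4]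

set_option maxHeartbeats 800000 in
/-- ★★ **A unit of `B₄` (odd constant coordinate) has `N_{L/K} ≡ ±1 (mod 64)`**: `z = a₀(1 +
      s₄w)`, `a₀^{16} ≡ 1 (mod 64)`, and the filtration at `j = 1`.
[cite: NeukirchANT1999, Ch. V §1 (norm group of `ℚ₂(ζ_{2ⁿ})`: `(2) × U^{(n)}`)] [cite: Omeara1963, §63B] -/
theorem exists_norm_eq_of_odd [FiniteDimensional K K₁] [IsGalois K K₁] [FiniteDimensional K₁ K₂] [IsGalois K₁ K₂] [FiniteDimensional K₂ K₃] [IsGalois K₂ K₃] [FiniteDimensional K₃ L] [IsGalois K₃ L]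
    (h1 : Module.finrank K K₁ = 2) (h2 : Module.finrank K₁ K₂ = 2) (h3 : Module.finrank K₂ K₃ = 2) (h4 : Module.finrank K₃ L = 2)
    {s₁ : K₁} (hs₁ : s₁ ^ 2 = 2) {s₂ : K₂} (hs₂ : s₂ ^ 2 = algebraMap K₁ K₂ (2 + s₁)) {s₃ : K₃} (hs₃ : s₃ ^ 2 = algebraMap K₂ K₃ (2 +
          s₂)) (hs₁K : ∀ k : K, algebraMap K K₁ k ≠ s₁) (hs₂K : ∀ x : K₁, algebraMap K₁ K₂ x ≠ s₂) (hs₃K : ∀ x : K₂, algebraMap K₂ K₃ x ≠ s₃)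
    {s₄ : L} (hs₄ : s₄ ^ 2 = algebraMap K₃ L (2 + s₃)) (hs₄K : ∀ x : K₃, algebraMap K₃ L x ≠ s₄)
    (hdig : ∀ r : S, ∃ q : S, r = 2 * q ∨ r = 1 + 2 * q) (hloc : ∀ r : S, IsUnit (1 + 2 * r)) (a b : Fin 8 → S) (e : S) (ha : a 0 = 1 + 2 * e) :
    ∃ σ : ℤ, ∃ q : S, (σ = 1 ∨ σ = -1) ∧ Algebra.norm K (algebraMap K₃ L (algebraMap K K₃ (a 0 : K) +
          algebraMap K K₃ (a 1 : K) * algebraMap K₁ K₃ s₁ + (algebraMap K K₃ (a 2 : K) +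
          algebraMap K K₃ (a 3 : K) * algebraMap K₁ K₃ s₁) * algebraMap K₂ K₃ s₂ + (algebraMap K K₃ (a 4 : K) +
          algebraMap K K₃ (a 5 : K) * algebraMap K₁ K₃ s₁ + (algebraMap K K₃ (a 6 : K) +
          algebraMap K K₃ (a 7 : K) * algebraMap K₁ K₃ s₁) * algebraMap K₂ K₃ s₂) * s₃) + algebraMap K₃ L (algebraMap K K₃ (b 0 : K) +
          algebraMap K K₃ (b 1 : K) * algebraMap K₁ K₃ s₁ + (algebraMap K K₃ (b 2 : K) +
          algebraMap K K₃ (b 3 : K) * algebraMap K₁ K₃ s₁) * algebraMap K₂ K₃ s₂ + (algebraMap K K₃ (b 4 : K) +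
          algebraMap K K₃ (b 5 : K) * algebraMap K₁ K₃ s₁ + (algebraMap K K₃ (b 6 : K) +
          algebraMap K K₃ (b 7 : K) * algebraMap K₁ K₃ s₁) * algebraMap K₂ K₃ s₂) * s₃) * s₄) = (σ : K) + 64 * (q : K) := by
  obtain ⟨hT₁, hT₂, hT₃, hT₄⟩ := rel₄ hs₁ hs₂ hs₃ hs₄
  set T₁ := algebraMap K₃ L (algebraMap K₁ K₃ s₁) with hT₁def
  set T₂ := algebraMap K₃ L (algebraMap K₂ K₃ s₂) with hT₂def
  set T₃ := algebraMap K₃ L s₃ with hT₃def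
  have hsplit : algebraMap K₃ L (algebraMap K K₃ (a 0 : K) + algebraMap K K₃ (a 1 : K) * algebraMap K₁ K₃ s₁ + (algebraMap K K₃ (a 2 : K) +
        algebraMap K K₃ (a 3 : K) * algebraMap K₁ K₃ s₁) * algebraMap K₂ K₃ s₂ + (algebraMap K K₃ (a 4 : K) +
        algebraMap K K₃ (a 5 : K) * algebraMap K₁ K₃ s₁ + (algebraMap K K₃ (a 6 : K) +
        algebraMap K K₃ (a 7 : K) * algebraMap K₁ K₃ s₁) * algebraMap K₂ K₃ s₂) * s₃) + algebraMap K₃ L (algebraMap K K₃ (b 0 : K) +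
        algebraMap K K₃ (b 1 : K) * algebraMap K₁ K₃ s₁ + (algebraMap K K₃ (b 2 : K) +
        algebraMap K K₃ (b 3 : K) * algebraMap K₁ K₃ s₁) * algebraMap K₂ K₃ s₂ + (algebraMap K K₃ (b 4 : K) +
        algebraMap K K₃ (b 5 : K) * algebraMap K₁ K₃ s₁ + (algebraMap K K₃ (b 6 : K) +
        algebraMap K K₃ (b 7 : K) * algebraMap K₁ K₃ s₁) * algebraMap K₂ K₃ s₂) * s₃) * s₄ =
      algebraMap K L (a 0 : K) + (algebraMap K₃ L (algebraMap K K₃ (![0, a 1, a 2, a 3, a 4, a 5, a 6, a 7] 0 : K) +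
            algebraMap K K₃ (![0, a 1, a 2, a 3, a 4, a 5, a 6, a 7] 1 : K) * algebraMap K₁ K₃ s₁ +
            (algebraMap K K₃ (![0, a 1, a 2, a 3, a 4, a 5, a 6, a 7] 2 : K) +
            algebraMap K K₃ (![0, a 1, a 2, a 3, a 4, a 5, a 6, a 7] 3 : K) * algebraMap K₁ K₃ s₁) * algebraMap K₂ K₃ s₂ +
            (algebraMap K K₃ (![0, a 1, a 2, a 3, a 4, a 5, a 6, a 7] 4 : K) +
            algebraMap K K₃ (![0, a 1, a 2, a 3, a 4, a 5, a 6, a 7] 5 : K) * algebraMap K₁ K₃ s₁ +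
            (algebraMap K K₃ (![0, a 1, a 2, a 3, a 4, a 5, a 6, a 7] 6 : K) +
            algebraMap K K₃ (![0, a 1, a 2, a 3, a 4, a 5, a 6, a 7] 7 : K) * algebraMap K₁ K₃ s₁) * algebraMap K₂ K₃ s₂) * s₃) +
            algebraMap K₃ L (algebraMap K K₃ (b 0 : K) + algebraMap K K₃ (b 1 : K) * algebraMap K₁ K₃ s₁ + (algebraMap K K₃ (b 2 : K) +
            algebraMap K K₃ (b 3 : K) * algebraMap K₁ K₃ s₁) * algebraMap K₂ K₃ s₂ + (algebraMap K K₃ (b 4 : K) +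
            algebraMap K K₃ (b 5 : K) * algebraMap K₁ K₃ s₁ + (algebraMap K K₃ (b 6 : K) +
            algebraMap K K₃ (b 7 : K) * algebraMap K₁ K₃ s₁) * algebraMap K₂ K₃ s₂) * s₃) * s₄) := by
    push_cast [Matrix.cons_val_zero, Matrix.cons_val_one, Matrix.cons_val, coe_ofNat_subring, map_ofNat, map_one, map_zero, map_neg, ← IsScalarTower.algebraMap_apply, ← hT₁def, ← hT₂def, ← hT₃def]
    ring
  obtain ⟨a₁, b₁, h₁⟩ := exists_eq_s4_mul_of_even S hs₁ hs₂ hs₃ hs₄ ![0, a 1, a 2, a 3, a 4, a 5, a 6, a 7] b 0 (by simp)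
  obtain ⟨u, hu⟩ := hloc e
  obtain ⟨a₂, b₂, h₂⟩ := exists_smul_eq S hs₁ hs₂ hs₃ hs₄ (↑u⁻¹ : S) a₁ b₁
  have hinv : ((1 + 2 * e : S) : K) * (((↑u⁻¹ : S)) : K) = 1 := by
    rw [← hu]; exact_mod_cast u.mul_inv
  have hinvL := congrArg (algebraMap K L) hinv
  rw [map_mul, map_one] at hinvL
  have hfac : algebraMap K₃ L (algebraMap K K₃ (a 0 : K) + algebraMap K K₃ (a 1 : K) * algebraMap K₁ K₃ s₁ + (algebraMap K K₃ (a 2 : K) +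
        algebraMap K K₃ (a 3 : K) * algebraMap K₁ K₃ s₁) * algebraMap K₂ K₃ s₂ + (algebraMap K K₃ (a 4 : K) +
        algebraMap K K₃ (a 5 : K) * algebraMap K₁ K₃ s₁ + (algebraMap K K₃ (a 6 : K) +
        algebraMap K K₃ (a 7 : K) * algebraMap K₁ K₃ s₁) * algebraMap K₂ K₃ s₂) * s₃) + algebraMap K₃ L (algebraMap K K₃ (b 0 : K) +
        algebraMap K K₃ (b 1 : K) * algebraMap K₁ K₃ s₁ + (algebraMap K K₃ (b 2 : K) +
        algebraMap K K₃ (b 3 : K) * algebraMap K₁ K₃ s₁) * algebraMap K₂ K₃ s₂ + (algebraMap K K₃ (b 4 : K) +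
        algebraMap K K₃ (b 5 : K) * algebraMap K₁ K₃ s₁ + (algebraMap K K₃ (b 6 : K) +
        algebraMap K K₃ (b 7 : K) * algebraMap K₁ K₃ s₁) * algebraMap K₂ K₃ s₂) * s₃) * s₄ =
      algebraMap K L (a 0 : K) * (1 + s₄ * (algebraMap K₃ L (algebraMap K K₃ (a₂ 0 : K) + algebraMap K K₃ (a₂ 1 : K) * algebraMap K₁ K₃ s₁ +
            (algebraMap K K₃ (a₂ 2 : K) + algebraMap K K₃ (a₂ 3 : K) * algebraMap K₁ K₃ s₁) * algebraMap K₂ K₃ s₂ + (algebraMap K K₃ (a₂ 4 : K) +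
            algebraMap K K₃ (a₂ 5 : K) * algebraMap K₁ K₃ s₁ + (algebraMap K K₃ (a₂ 6 : K) +
            algebraMap K K₃ (a₂ 7 : K) * algebraMap K₁ K₃ s₁) * algebraMap K₂ K₃ s₂) * s₃) + algebraMap K₃ L (algebraMap K K₃ (b₂ 0 : K) +
            algebraMap K K₃ (b₂ 1 : K) * algebraMap K₁ K₃ s₁ + (algebraMap K K₃ (b₂ 2 : K) +
            algebraMap K K₃ (b₂ 3 : K) * algebraMap K₁ K₃ s₁) * algebraMap K₂ K₃ s₂ + (algebraMap K K₃ (b₂ 4 : K) +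
            algebraMap K K₃ (b₂ 5 : K) * algebraMap K₁ K₃ s₁ + (algebraMap K K₃ (b₂ 6 : K) +
            algebraMap K K₃ (b₂ 7 : K) * algebraMap K₁ K₃ s₁) * algebraMap K₂ K₃ s₂) * s₃) * s₄)) := by
    rw [← h₂, hsplit, h₁, ha]
    linear_combination (-(s₄ * (algebraMap K₃ L (algebraMap K K₃ (a₁ 0 : K) + algebraMap K K₃ (a₁ 1 : K) * algebraMap K₁ K₃ s₁ +
          (algebraMap K K₃ (a₁ 2 : K) + algebraMap K K₃ (a₁ 3 : K) * algebraMap K₁ K₃ s₁) * algebraMap K₂ K₃ s₂ + (algebraMap K K₃ (a₁ 4 : K) +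
          algebraMap K K₃ (a₁ 5 : K) * algebraMap K₁ K₃ s₁ + (algebraMap K K₃ (a₁ 6 : K) +
          algebraMap K K₃ (a₁ 7 : K) * algebraMap K₁ K₃ s₁) * algebraMap K₂ K₃ s₂) * s₃) + algebraMap K₃ L (algebraMap K K₃ (b₁ 0 : K) +
          algebraMap K K₃ (b₁ 1 : K) * algebraMap K₁ K₃ s₁ + (algebraMap K K₃ (b₁ 2 : K) +
          algebraMap K K₃ (b₁ 3 : K) * algebraMap K₁ K₃ s₁) * algebraMap K₂ K₃ s₂ + (algebraMap K K₃ (b₁ 4 : K) +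
          algebraMap K K₃ (b₁ 5 : K) * algebraMap K₁ K₃ s₁ + (algebraMap K K₃ (b₁ 6 : K) +
          algebraMap K K₃ (b₁ 7 : K) * algebraMap K₁ K₃ s₁) * algebraMap K₂ K₃ s₂) * s₃) * s₄))) * hinvL
  obtain ⟨σ, q, hσ, hN⟩ := exists_norm_one_add_s4_pow_mul S h1 h2 h3 h4 hs₁ hs₂ hs₃ hs₁K hs₂K hs₃K hs₄ hs₄K hdig 15 le_rfl a₂ b₂
  rw [show 16 - 15 = 1 from rfl, pow_one] at hN
  obtain ⟨r, hr⟩ := exists_pow_sixteen_eq S hdig e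
  have hrK : ((1 : K) + 2 * (e : K)) ^ 16 = 1 + 64 * (r : K) := by exact_mod_cast hr
  refine ⟨σ, r * σ + q + 64 * r * q, hσ, ?_⟩
  rw [hfac, map_mul, Algebra.norm_algebraMap, finrank_eq_sixteen h1 h2 h3 h4, hN, ha]
  push_cast
  linear_combination ((σ : K) + 64 * (q : K)) * hrK

/-- ★★★ **THE LEVEL-`64` DYADIC LEMMA.**  `K ⊂ K₁ ⊂ K₂ ⊂ K₃ ⊂ L` a tower of Galois quadratic steps `s₁² = 2`, `s₂² = 2 + s₁`, `s₃² = 2 +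
      s₂`, `s₄² = 2 + s₃`
(`s_i` outside the previous field; a model of `K_4 = K·ℚ(ζ₆₄)⁺`); `S ⊆ K` a subring in which every element is `2q` or `1 + 2q`, every `1 +
      2q` is a unit and
`2` is not (e.g. `(𝓞_K)_𝔭` at a dyadic prime with `e = f = 1`); `z = A + B s₄` with `A, B ∈ K₃` having their eight tower coordinates in `S`.  If
**`N_{L/K}(z) = 2^m · u`** with `u` a unit of `S` then **`u ≡ ±1 (mod 64 S)`** (units: `exists_norm_eq_of_odd`; otherwise `z = s₄ z'`, `N(s₄) = 2`, induction on `m`).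
This is the elementary content of «the norm group of `ℚ₂(ζ₆₄)⁺/ℚ₂` on units is `±1 +
      64ℤ₂`» (local class field theory), in the one direction the doors need.
[cite: NeukirchANT1999, Ch. V §1 (norm group of `ℚ_p(ζ_{pⁿ})`: `(p) × U^{(n)}`)] [cite: Omeara1963, §63B] [cite: Washington1997, §13.1] -/
theorem exists_eq_of_norm_eq_pow_mul [FiniteDimensional K K₁] [IsGalois K K₁] [FiniteDimensional K₁ K₂] [IsGalois K₁ K₂] [FiniteDimensional K₂ K₃] [IsGalois K₂ K₃] [FiniteDimensional K₃ L] [IsGalois K₃ L]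
    (h1 : Module.finrank K K₁ = 2) (h2 : Module.finrank K₁ K₂ = 2) (h3 : Module.finrank K₂ K₃ = 2) (h4 : Module.finrank K₃ L = 2)
    {s₁ : K₁} (hs₁ : s₁ ^ 2 = 2) {s₂ : K₂} (hs₂ : s₂ ^ 2 = algebraMap K₁ K₂ (2 + s₁)) {s₃ : K₃} (hs₃ : s₃ ^ 2 = algebraMap K₂ K₃ (2 +
          s₂)) (hs₁K : ∀ k : K, algebraMap K K₁ k ≠ s₁) (hs₂K : ∀ x : K₁, algebraMap K₁ K₂ x ≠ s₂) (hs₃K : ∀ x : K₂, algebraMap K₂ K₃ x ≠ s₃)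
    {s₄ : L} (hs₄ : s₄ ^ 2 = algebraMap K₃ L (2 + s₃)) (hs₄K : ∀ x : K₃, algebraMap K₃ L x ≠ s₄)
    (hdig : ∀ r : S, ∃ q : S, r = 2 * q ∨ r = 1 + 2 * q) (hloc : ∀ r : S, IsUnit (1 + 2 * r)) (h2S : ¬ IsUnit (2 : S)) (m : ℕ) :
    ∀ (a b : Fin 8 → S) (u : S), IsUnit u →
      Algebra.norm K (algebraMap K₃ L (algebraMap K K₃ (a 0 : K) + algebraMap K K₃ (a 1 : K) * algebraMap K₁ K₃ s₁ + (algebraMap K K₃ (a 2 : K) +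
            algebraMap K K₃ (a 3 : K) * algebraMap K₁ K₃ s₁) * algebraMap K₂ K₃ s₂ + (algebraMap K K₃ (a 4 : K) +
            algebraMap K K₃ (a 5 : K) * algebraMap K₁ K₃ s₁ + (algebraMap K K₃ (a 6 : K) +
            algebraMap K K₃ (a 7 : K) * algebraMap K₁ K₃ s₁) * algebraMap K₂ K₃ s₂) * s₃) + algebraMap K₃ L (algebraMap K K₃ (b 0 : K) +
            algebraMap K K₃ (b 1 : K) * algebraMap K₁ K₃ s₁ + (algebraMap K K₃ (b 2 : K) +
            algebraMap K K₃ (b 3 : K) * algebraMap K₁ K₃ s₁) * algebraMap K₂ K₃ s₂ + (algebraMap K K₃ (b 4 : K) +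
            algebraMap K K₃ (b 5 : K) * algebraMap K₁ K₃ s₁ + (algebraMap K K₃ (b 6 : K) +
            algebraMap K K₃ (b 7 : K) * algebraMap K₁ K₃ s₁) * algebraMap K₂ K₃ s₂) * s₃) * s₄) = 2 ^ m * (u : K) →
      ∃ q : S, u = 1 + 64 * q ∨ u = -1 + 64 * q := by
  have hndvd1 : ∀ y : S, (1 : S) ≠ 2 * y := fun y hy => h2S (isUnit_of_dvd_one ⟨y, hy⟩)
  have h2K : (2 : K) ≠ 0 := by
    intro h
    apply hs₁K 0
    have h2 : (2 : K₁) = 0 := by rw [← map_ofNat (algebraMap K K₁) 2, h, map_zero]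
    rw [map_zero]
    exact (pow_eq_zero_iff two_ne_zero).mp (hs₁.trans h2) |>.symm
  induction m with
  | zero =>
    intro a b u hu hN
    rw [pow_zero, one_mul] at hN
    obtain ⟨e, ha | ha⟩ := hdig (a 0)
    · exfalso
      obtain ⟨a', b', h⟩ := exists_eq_s4_mul_of_even S hs₁ hs₂ hs₃ hs₄ a b e ha
      obtain ⟨n, hn⟩ := exists_norm_eq_coe S h1 h2 h3 h4 hs₁ hs₂ hs₃ hs₁K hs₂K hs₃K hs₄ hs₄K a' b'
      rw [h, norm_s4_mul h1 h2 h3 h4 hs₁ hs₂ hs₃ hs₁K hs₂K hs₃K hs₄ hs₄K, hn] at hN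
      have hu2 : u = 2 * n := by exact_mod_cast hN.symm
      exact h2S (isUnit_of_dvd_unit ⟨n, hu2⟩ hu)
    · obtain ⟨σ, q, hσ, hN'⟩ := exists_norm_eq_of_odd S h1 h2 h3 h4 hs₁ hs₂ hs₃ hs₁K hs₂K hs₃K hs₄ hs₄K hdig hloc a b e ha
      rw [hN] at hN'
      rcases hσ with rfl | rfl
      · exact ⟨q, Or.inl (by exact_mod_cast hN')⟩
      · exact ⟨q, Or.inr (by exact_mod_cast hN')⟩
  | succ m ih =>
    intro a b u hu hN
    obtain ⟨e, ha | ha⟩ := hdig (a 0)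
    · obtain ⟨a', b', h⟩ := exists_eq_s4_mul_of_even S hs₁ hs₂ hs₃ hs₄ a b e ha
      rw [h, norm_s4_mul h1 h2 h3 h4 hs₁ hs₂ hs₃ hs₁K hs₂K hs₃K hs₄ hs₄K] at hN
      exact ih a' b' u hu (mul_left_cancel₀ h2K (by rw [hN]; ring))
    · exfalso
      obtain ⟨σ, q, hσ, hN'⟩ := exists_norm_eq_of_odd S h1 h2 h3 h4 hs₁ hs₂ hs₃ hs₁K hs₂K hs₃K hs₄ hs₄K hdig hloc a b e ha
      rw [hN] at hN'
      rcases hσ with rfl | rfl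
      · have h' : (2 : S) ^ (m + 1) * u = 1 + 64 * q := by exact_mod_cast hN'
        exact hndvd1 (2 ^ m * u - 32 * q) (by linear_combination -h')
      · have h' : (2 : S) ^ (m + 1) * u = -1 + 64 * q := by exact_mod_cast hN'
        exact hndvd1 (32 * q - 2 ^ m * u) (by linear_combination h')

/-- ★★★ **COROLLARY (the form the doors use).**  Same setting; `η` a unit of `S` with `η − 1 ∉ 64S`, `η +
      1 ∉ 64S`, `v` a unit.  Then `N_{L/K}(z) ≠ 2^{16k}·(v^{16}η)`
for every `z = A + B s₄` with coordinates in `S`: a norm `t^{16}·η` (`t = 2^k v` a cleared denominator) is impossible.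
[cite: NeukirchANT1999, Ch. V §1 (norm group of `ℚ_p(ζ_{pⁿ})`)] [cite: Omeara1963, §63B] -/
theorem norm_ne_pow_mul_of_not_congr [FiniteDimensional K K₁] [IsGalois K K₁] [FiniteDimensional K₁ K₂] [IsGalois K₁ K₂] [FiniteDimensional K₂ K₃] [IsGalois K₂ K₃] [FiniteDimensional K₃ L] [IsGalois K₃ L]
    (h1 : Module.finrank K K₁ = 2) (h2 : Module.finrank K₁ K₂ = 2) (h3 : Module.finrank K₂ K₃ = 2) (h4 : Module.finrank K₃ L = 2)
    {s₁ : K₁} (hs₁ : s₁ ^ 2 = 2) {s₂ : K₂} (hs₂ : s₂ ^ 2 = algebraMap K₁ K₂ (2 + s₁)) {s₃ : K₃} (hs₃ : s₃ ^ 2 = algebraMap K₂ K₃ (2 +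
          s₂)) (hs₁K : ∀ k : K, algebraMap K K₁ k ≠ s₁) (hs₂K : ∀ x : K₁, algebraMap K₁ K₂ x ≠ s₂) (hs₃K : ∀ x : K₂, algebraMap K₂ K₃ x ≠ s₃)
    {s₄ : L} (hs₄ : s₄ ^ 2 = algebraMap K₃ L (2 + s₃)) (hs₄K : ∀ x : K₃, algebraMap K₃ L x ≠ s₄)
    (hdig : ∀ r : S, ∃ q : S, r = 2 * q ∨ r = 1 + 2 * q) (hloc : ∀ r : S, IsUnit (1 +
          2 * r)) (h2S : ¬ IsUnit (2 : S)) {η v : S} (hη : IsUnit η) (hv : IsUnit v)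
    (hη1 : ∀ q : S, η ≠ 1 + 64 * q) (hη2 : ∀ q : S, η ≠ -1 + 64 * q) (k : ℕ) (a b : Fin 8 → S) :
    Algebra.norm K (algebraMap K₃ L (algebraMap K K₃ (a 0 : K) + algebraMap K K₃ (a 1 : K) * algebraMap K₁ K₃ s₁ + (algebraMap K K₃ (a 2 : K) +
          algebraMap K K₃ (a 3 : K) * algebraMap K₁ K₃ s₁) * algebraMap K₂ K₃ s₂ + (algebraMap K K₃ (a 4 : K) +
          algebraMap K K₃ (a 5 : K) * algebraMap K₁ K₃ s₁ + (algebraMap K K₃ (a 6 : K) +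
          algebraMap K K₃ (a 7 : K) * algebraMap K₁ K₃ s₁) * algebraMap K₂ K₃ s₂) * s₃) + algebraMap K₃ L (algebraMap K K₃ (b 0 : K) +
          algebraMap K K₃ (b 1 : K) * algebraMap K₁ K₃ s₁ + (algebraMap K K₃ (b 2 : K) +
          algebraMap K K₃ (b 3 : K) * algebraMap K₁ K₃ s₁) * algebraMap K₂ K₃ s₂ + (algebraMap K K₃ (b 4 : K) +
          algebraMap K K₃ (b 5 : K) * algebraMap K₁ K₃ s₁ + (algebraMap K K₃ (b 6 : K) +
          algebraMap K K₃ (b 7 : K) * algebraMap K₁ K₃ s₁) * algebraMap K₂ K₃ s₂) * s₃) * s₄) ≠ 2 ^ (16 * k) * ((v ^ 16 * η : S) : K) := by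
  intro h
  obtain ⟨q, hq⟩ := exists_eq_of_norm_eq_pow_mul S h1 h2 h3 h4 hs₁ hs₂ hs₃ hs₁K hs₂K hs₃K hs₄ hs₄K hdig hloc h2S (16 * k) a b
    (v ^ 16 * η) ((hv.pow 16).mul hη) h
  obtain ⟨r, hr⟩ := exists_unit_pow_sixteen_eq S hdig h2S hv
  rw [hr] at hq
  rcases hq with hq | hq
  · exact hη1 (q - r * η) (by linear_combination hq)
  · exact hη2 (q - r * η) (by linear_combination hq)

end Literature.NumberTheory.NumberFields.SqrtTwoTowerFour

end
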